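/-
Copyright: statement-level skeleton of a published paper (lit-balaban cell, Phase-2 proof seat p26 gen 44). No claims beyond
what the kernel checks below.
-/
import Mathlib
import Literature.MathematicalPhysics.QuantumFieldTheory.Balaban1983to89.B3GraphAmplitudePositionForm
import Literature.MathematicalPhysics.QuantumFieldTheory.Balaban1983to89.B3Eq326FromFeynmanRules
import Literature.MathematicalPhysics.QuantumFieldTheory.Balaban1983to89.B3DifferentiatedLineKernels

/-!
# B3 — T. Bałaban, *(Higgs)₂,₃ quantum fields in a finite volume. III. Renormalization*, CMP **88** (1983) 411–445
[Balaban1983Higgs3] — p. 426 [PDF 16]: **THE FIRST ESTIMATE IN SIGNED POSITION FORM — EACH DIFFERENTIATION BOOKED ON ITS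
LINE ((2.11))**.  FILE 14 of the evaluator lineage (item 5 of `HOME/lit-balaban-p26/DESIGN-B3-evaluator.md`), the companion of
FILE 12 (`B3GraphAmplitudePositionForm`).

statement-level skeleton of published theorems with citation tags; proofs where landed; nothing here is a claim about
the Yang–Mills mass gap

PDF held: `paper:balaban1983-higgs-2-3-quantum-fields-finite-volume` (journal page = PDF page + 410); p. 426 [PDF 16] read by
this seat on the text layer `~/.lit/texts/paper-balaban1983-higgs-2-3-quantum-fields-finite-volume/p0016.txt` (2026-08-24).

CITATION HEADER (lean-in-tree rule).  lit-balaban TYPED SKELETON (HOME `run/shared/lean/pub/lit-balaban/`), PHASE 2, seat p26 gen 44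
(unit `lit-balaban-p26`; free-target protocol G.5-34(d), own lane, TAKING announced HOME/STATUS.md 2026-08-24T11:12Z; the evaluator
lineage FILE 1 `B3GraphAmplitude` p361338, FILE 2 `B3GraphAmplitudeRules` p362438, FILE 5 `B3Eq39FromFeynmanRules`, FILE 6
`B3Eq326FromFeynmanRules`, FILE 9 `B3GraphAmplitudeMajorant` p368098, FILE 12 `B3GraphAmplitudePositionForm` p378154).  ROWS
**B3.Eq2.13-2.14** ((2.13) p. 426; head by p19 `B3Ineq213Proof`), **B3.Prop1** (p. 420), **B3.Def@420** of `HOME/lit-balaban-r15/ROWS-B3.md`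
(fold owner r15; cells only — an OPTIONAL located member, zero head weight).  CONSUMES BY NAME, nothing re-declared: FILE 1's
`Pairing`, `SLeg/VLeg/OLeg`, `sPairing/vPairing`, `sRank/vRank/oRank` + `…_injective`, `SLine/VLine/ExtSLeg/ExtVLeg`, `Rules`,
`OutPairing`, `vertexFactor`, `sLineFactor`, `vLineFactor`, `oLineFactor`, `amp`; FILE 2's `basisE`, `basisV`, `rule16`–`rule111`,
`rule113`–`rule115`, `avg114`, `avg115`, `pleg18`, `pleg110`, `vlegs`, `Model`, `Loc`, `ruleOfKind`, `rulesOf`, `graphAmp`, `inner_basisE`;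
FILE 5's `dKs`; FILE 6's `dK1`, `dK2`; FILE 9's `norm_qpow_apply_le`; FILE 15's `B3DifferentiatedLineKernels.covDeriv_sum_smul_basisE`; FILE 12's `sum_assign_factor`, `attB`, `sum_attB_mul`, `bondData`,
`u18`, `Lines`, `lineSrc`, `lineTgt`, `lineKer`, `extAt`, `positionForm_eq_lines`, `sum_positions_eq_boxSum`, `ampOf`, `E_ampOf`,
`modelOfGraph`; `B3Eq36TadpoleExpressions.basisE_eq`; `B3Eq114AveragingVertices.vertex113`; the typer's `HiggsLattice.{Site, PBond,
ScalarField, VecField, ChargeData, covDeriv, mesh_pos}`, `HiggsAveraging.{blockK, blockIter}`, `B3Eq18VertexExpansion.remTensor`,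
`B3VertexTensorBounds.taylorRemOp`, r15's `B3Prop1.VertexKind`; p19's `B3Ineq213.{Amp, pts, boxPositions, supDist, LinesConnect}` and
`B3Ineq215.{Model, Cube}`; Mathlib's `PiLp.norm_apply_le`, `PiLp.norm_single`, `EuclideanSpace.inner_single_left/right`.

THE PRINTED TEXT (verbatim, p. 426 [PDF 16]).  *"For the propagators G^η_{(j)} we apply the inequality
|G^η_{(j)}(Ω, B̃; x, x′)| ≦ O(1)(L^jη)^{−d+2}e^{−δ₁(L^jη)^{−1}|x−x′|}, (2.10) and if the propagator is differentiated, then for each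
differentiation, there is an additional factor (L^jη)^{−1} on the right side. This applies also to Hölder norms, e.g. we have …
(2.11) … Finally in vertices we apply the inequalities |q| ≦ 1, |R_{n̄+1}(·)| ≦ 1."*  (2.14) p. 427 then books the powers of `L^jη` per
LINE (p19's `B3Ineq213Amplitude.Amp`: `a_l` carries `−1` per differentiation, `e_nonneg : 0 ≤ e_v`).

WHY THIS FILE (declared).  FILE 12 §§2–4 attach a DIFFERENTIATED φ′-leg of (1.8)/(1.9) by the triangle inequality on the covariant
difference quotient (`norm_covDeriv_basisE_le_attD`: `‖(D_B̃ δ_p)(b)‖ ≤ η⁻¹ attD(b₋, p)`) and therefore book the `η⁻¹` in the VERTEX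
function (`u18`, `u19` carry `η^{n+n′−2}` beyond `η^d`); print books it on the LINE ((2.11) is a bound on `D G_{(j)}` itself, better than
`η⁻¹|G_{(j)}|` by `L^{−j}`).  Consequently, for every graph with a (1.8)_{1,0} or (1.8)_{0,1} vertex, FILE 12 §7's hypothesis `u_le` cannot
be met with `e_v ≥ 0` from `uOfKind`, and `K_le` fed by (2.10) alone is weaker than (2.14)'s weight by `L^{+j_l}` per derivative.  The
unsigned leg weights `ρ ≥ 0` of FILE 12 §2 cannot encode the signed difference `U(B̃_b)δ_{b₊} − δ_{b₋}`; it has to be contracted with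
the propagator BEFORE absolute values are taken.  READING: (§1, abstract, FILE-1 level) if every vertex rule on basis fields FACTORS
over its legs after a finite sum over LABELS, `V_i(b∘a) = Σ_ξ ū_i(ξ) Π_j σ_ij(ξ, a_j)` with SIGNED weights `σ`, then — FILE 12 §1's
`sum_assign_factor` being an identity — `amp` EQUALS the sum over label assignments of `Π_i ū_i(ξ_i)` times the external contractions
times ONE SIGNED EFFECTIVE KERNEL PER LINE `k_l(ξ, ξ′) = Σ_{p,p′} σ σ′ K_l(p,p′)` (**`amp_eq_labelForm`**, no absolute value taken); then
`|amp| ≤ Σ_x Π_i U_i(x_i) · Π_e n_e · Π_l K̄_l(x_{v_l}, x_{v′_l})` for any non-negative `K̄_l` dominating `|k_l|` between the POSITIONS of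
the labels and `U_i(x) ≥ Σ_{ξ ↦ x}|ū_i(ξ)|` (**`abs_amp_le_positionForm_signed`**) — the output shape of FILE 12 §2, so FILE 12 §§6–7
apply verbatim; (§2) the SIGNED attachments `sigS` (`[p = (x,c)]`), **`sigD`** (`((D_B̃ δ_p)(b))_c`, sign and gauge factor kept), `sigB`,
`sigO`, collapsing lemmas, the exact bracket evaluations **`inner_basisE_op_basisE`**, **`inner_covDeriv_basisE_op_basisE`**,
`inner_basisE_basisE_sig`, `vlegs_basisV`, **`avg_basis_labelForm`**, and the CONTRACTION IDENTITIES naming the effective line kernels: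
`sum2_sigS_sigS` (entry), **`sum2_sigD_sigS = dK1`**, **`sum2_sigS_sigD = dK2`**, **`sum2_sigD_sigD = dKs`** (FILE 5/6's differentiated line
kernels — exactly the blocks in which FILEs 5–7, 13 evaluate the concrete pictures), `sum2_sigB_sigB`, `sum2_sigO_sigO`, and for the
EXTERNAL legs `sum_sigS_field` (`= φ(x)_c`), **`sum_sigD_field`** (`= ((D^η_B̃ φ)(b))_c`: a differentiated external leg reads the covariant
derivative of the external field), **`extS_signed_contraction`** (FILE 2's product external fields: the signed contraction is the product
of the single-leg evaluations), and for the AVERAGED A′-legs of (1.14)/(1.15) with a LINEAR contour functional `ctr a x = Σ_b w(x,b)a(b)`: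
`sum_ctr_basisV_mul`, **`sum2_ctr_ctr`** (two averaged legs: the doubly contour-averaged covariance `⟨A′(Γ_{·,x})A′(Γ_{·,x′})⟩`),
**`sum2_ctr_sigB`** ∕ `sum2_sigB_ctr` (one averaged leg: `G^η_{(j)}(Γ^{(j+1)}_{x_{j+1},x}, b)` — the OBJECT of (2.12); its factor `L^jη` is the
instantiating seat's bound, not claimed here); (§3) the
label type **`Lab`** (`(site ⊕ bond) × channel × channel`), `Lab.pos`, the per-kind signed attachments **`sigSK`**, **`sigVK`**, **`sigOK`**,
the per-site operators `op113`, `op114`, `op115`, the vertex COEFFICIENT **`ubOfKind`** (couplings, the printed `η`-powers — `η^{n+n′−1}`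
for (1.8) — cut-offs, `Ã`-powers, localization weight and the channel tensor `δ_{cc′}` ∕ `(q^m e_{c′})_c` ∕ `(q^m R_{n̄+1} e_{c′})_c` ∕
`(U(B̃(Γ)) e_c)_{c′}`), the EXACT label forms of the nine printed vertices `labelForm_v16`, `labelForm_v17`, **`labelForm_v18`**,
`labelForm_v19`, `labelForm_v110`, `labelForm_v111`, `labelForm_v113`, `labelForm_v114`, `labelForm_v115` (with `vertex113_eq_sum_op`,
`avg114_eq_sum_op`, `avg115_eq_sum_op`) and the dispatch **`ruleOfKind_basis_labelForm`**; (§4) the vertex function **`UOf`**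
(`Σ_{ξ ↦ x}|ū(ξ)|`), **`graphAmp_eq_labelForm`** (E(G, {□(v)}, Φ_ext, A_ext) in exact label form, EVERY graph of p18's model),
**`abs_graphAmp_le_positionForm_signed`**, **`abs_graphAmp_le_lines_signed`**, **`abs_graphAmp_le_ampE_signed`** (into p19's `Amp` with `K_le`
fed in (2.11) currency and `u_le` from vertex functions without `η⁻¹`), **`UOf_v18_le`** (`UOf_(1.8) ≤ N²·η·u18`: the `η⁻¹` of FILE 12
§3 is gone, so for (1.8)_{1,0} the vertex power is `η^0·η^d` and p19's `e_v ≥ 0` is met), the helpers `UOf_le_of_site`, `UOf_le_of_bond`,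
the eight companions `UOf_v16_le` … `UOf_v115_le`, and the comparison **`UOf_le_uOfKind`**: for EVERY kind
`UOf_κ ≤ N² · η^{diffCount κ} · uOfKind_κ` — exactly one factor `η` per differentiated leg has moved from the vertex to the line.
WHICH BOOKING (r15's header ask (a)).  Print's (2.14) writes the factor as «Π_{differentiations in v acting on lines l}(L^{j_l}η)^{−1}»
inside the vertex product but indexed by the LINE's scale `j_l`; p19's `B3Ineq213Amplitude.Amp` books the same factor LINE-SIDE (`K_le`
with the line dimension `a_l` lowered by 1 per differentiation, `u_le` with `e_v ≥ 0`).  THIS FILE'S PACKAGING IS LINE-SIDE: in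
`abs_graphAmp_le_ampE_signed` the kernel family `K_l(t; x, x′)` fed to `ampOf` ∕ `E_ampOf` must dominate the signed effective kernel of the
line (`|dK1|`, `|dK2|`, `|dKs|` for lines at differentiated legs), i.e. it is (2.10)·(L^{j_l}η)^{−m_l} with `m_l` = the number of
differentiated legs of `l`, and the vertex side `UOf_v · extAt_v` carries only the printed `η`-powers (`UOf_le_uOfKind`), so p19's
`e_nonneg` is met for EVERY graph of p18's model — including those with (1.8)_{1,0} ∕ (1.8)_{0,1} vertices (④, ⑦, (3.21)₂, chain ends).
USE (r15's header ask (b)).  FILE 12's theorems stay correct as stated (all analytic inputs are hypotheses); IN p19's CURRENCY, FILE 12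
§7 (`abs_graphAmp_le_ampE`, `…_blocks`, §9 `abs_graphAmp_le_sum_ampE_blocks`) is the tool for graphs WITHOUT differentiated φ′-legs, and
this file's §4 (`abs_graphAmp_le_ampE_signed`) for ALL graphs; FILE 12 §§1, 6–8 (`sum_assign_factor`, `Lines`, `positionForm_eq_lines`,
`ampOf`, `E_ampOf`, `modelOfGraph`, the block chart) are used here unchanged.
HONEST SCOPE.  (a) Bookkeeping only (exact finite re-summations, then the triangle inequality): the bounds on the signed effective
kernels (`|dK1|`, `|dK2|`, `|dKs|` from (2.10)+(2.11) = rows B3.Eq2.10–2.11, Props I.2.1/I.2.3; entries from (2.10)/(2.12)/(1.18)) and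
on the signed external contractions (covariant derivatives of the external fields where a differentiated leg is external, *"estimated
further by the Hölder norms"*) are HYPOTHESES, as `K_le`/`u_le` are hypotheses of p19's `Amp`; no tree-length extraction, no summation
over positions (p19's `B3Ineq213Amplitude`/`B3Ineq213Proof`).  WHERE THE HYPOTHESES COME FROM (by name, not imported): at ZERO background
the line hypotheses are met by FILE 15's `abs_dK1_zero_free_le` ∕ `abs_dK2_zero_free_le` ∕ `abs_dKs_zero_free_le` fed with FILE 16's
`B3Ineq210ZeroHiggsTorus.gpieceH_bounds_massWindow` ∕ `gpieceH_mixed_bound` ∕ `gpieceH_bounds_model` (p03's ∕ p20's torus instances of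
(2.10) pulled back to this carrier; `opEntry_pieceA_zero`: the pieces of record are `(L^kε)²·pieceH_j ⊗ 1_N`); at a REGULAR background by
r14's `B3Ineq210RegularTorus` ∕ p40's `B3Ineq210MixedRegularTorus` ∕ `B3Ineq211RegularTorus` through FILE 15's `abs_dK1_le` (the colour-block
column norm dominates the entry); the passage from these TORUS-distance bounds to the BOX-distance shape of p19's `Amp.K_le` (the seam of the
chart) is FILE 17 `B3Eq213TorusBoxSeam` (`lineBound_labelChart_of_torusBound`, based chart `labelChartAt`; FILE 16 §8
`gpieceH_lineBounds_halfTorus` is the zero-background instance).  (b) The vertex functions `UOf` are finite sums; `UOf_le_uOfKind` bounds them by FILE 12's explicit `uOfKind` times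
`N²·η^{diffCount}` (the `N²` is the crude two-channel count, not optimized).
(c) FILE 12's chart caveat (torus versus label distance at the seam of `coordChart`) applies unchanged to `abs_graphAmp_le_ampE_signed`.
(d) Print never displays the label form; it is OUR device to keep the sign of the difference quotient until the line kernel has been
contracted, fixed so that the output is the input shape of (2.13)/(2.14) with print's line dimensions.  Unit `lit-balaban-p26` gen 44
(literature-prover-lit-balaban-p26-g44-0), HOME `run/shared/lean/pub/lit-balaban/`, 2026-08-24.
-/

open Finset
open scoped BigOperators

namespace Literature.MathematicalPhysics.QuantumFieldTheory.Balaban1983to89.B3GraphAmplitudeSignedPositionForm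

open Literature.MathematicalPhysics.QuantumFieldTheory.Balaban1983to89.B3Cor23Concrete (Graph)
open Literature.MathematicalPhysics.QuantumFieldTheory.Balaban1983to89.B3GraphAmplitude
open Literature.MathematicalPhysics.QuantumFieldTheory.Balaban1983to89.B3GraphAmplitudeRules
open Literature.MathematicalPhysics.QuantumFieldTheory.Balaban1983to89.B3GraphAmplitudeMajorant
open Literature.MathematicalPhysics.QuantumFieldTheory.Balaban1983to89.B3GraphAmplitudePositionForm

noncomputable section

/-! ## §1 The EXACT LABEL FORM and the SIGNED position form: each differentiation is booked on its LINE ((2.11) currency) -/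

section LabelForm

variable {nbar : ℕ} {G : Graph nbar} {SF VF OF : Type*} {IS IV IO X : Type*} [Fintype IS] [Fintype IV] [Fintype IO] [Fintype X]

/-- kernel: a product over the legs of a family of vertices is the iterated product vertex by vertex. [folklore] -/
private theorem prod_sigma_univ {ι : Type*} [Fintype ι] {κ : ι → Type*} [∀ i, Fintype (κ i)] (f : (Σ i, κ i) → ℝ) :
    ∏ x, f x = ∏ i, ∏ j, f ⟨i, j⟩ := by
  rw [← Finset.univ_sigma_univ, Finset.prod_sigma]

/-- kernel: a quadruple sum with the fourth index moved outermost. [folklore] -/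
private theorem sum3_sum_comm {A B C D : Type*} [Fintype A] [Fintype B] [Fintype C] [Fintype D]
    (f : A → B → C → D → ℝ) : ∑ a, ∑ b, ∑ c, ∑ d, f a b c d = ∑ d, ∑ a, ∑ b, ∑ c, f a b c d := by
  have h1 : ∀ a b, ∑ c, ∑ d, f a b c d = ∑ d, ∑ c, f a b c d := fun a b => Finset.sum_comm
  simp only [h1]
  have h2 : ∀ a, ∑ b, ∑ d, ∑ c, f a b c d = ∑ d, ∑ b, ∑ c, f a b c d := fun a => Finset.sum_comm
  simp only [h2]
  exact Finset.sum_comm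

/-- kernel: a constant factor leaves a triple sum. [folklore] -/
private theorem sum3_const_mul {A B C : Type*} [Fintype A] [Fintype B] [Fintype C] (P : ℝ) (f : A → B → C → ℝ) :
    ∑ a, ∑ b, ∑ c, P * f a b c = P * ∑ a, ∑ b, ∑ c, f a b c := by
  simp only [Finset.mul_sum]

/-- kernel: a triple sum of products of one-variable factors is the product of the three sums. [folklore] -/
private theorem sum3_mul {A B C : Type*} [Fintype A] [Fintype B] [Fintype C] (a : A → ℝ) (b : B → ℝ) (c : C → ℝ) :
    ∑ α, ∑ β, ∑ ο, a α * b β * c ο = (∑ α, a α) * (∑ β, b β) * ∑ ο, c ο := by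
  symm
  rw [Finset.sum_mul_sum, Finset.sum_mul]
  refine Finset.sum_congr rfl fun α _ => ?_
  rw [Finset.sum_mul]
  refine Finset.sum_congr rfl fun β _ => ?_
  rw [Finset.mul_sum]


/-- kernel: the sum over dependent label tuples with prescribed projections is the product of the fibre sums. [folklore] -/
private theorem sum_filter_proj_eq_prod {n : ℕ} {Ξ : Fin n → Type*} [∀ i, Fintype (Ξ i)] {X : Type*} [DecidableEq X]
    (pos : (i : Fin n) → Ξ i → X) (f : (i : Fin n) → Ξ i → ℝ) (x : Fin n → X) :
    ∑ ξ ∈ (Finset.univ : Finset ((i : Fin n) → Ξ i)).filter (fun ξ => (fun i => pos i (ξ i)) = x), ∏ i, f i (ξ i) =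
      ∏ i, ∑ ζ ∈ (Finset.univ : Finset (Ξ i)).filter (fun ζ => pos i ζ = x i), f i ζ := by
  rw [Finset.prod_univ_sum]
  refine Finset.sum_congr ?_ fun _ _ => rfl
  ext ξ
  simp only [Finset.mem_filter, Finset.mem_univ, true_and, Fintype.mem_piFinset, funext_iff]

/-- **THE EXACT LABEL FORM OF A GRAPH EXPRESSION** (the identity behind p. 426's first estimate, BEFORE any absolute value is
taken).  Suppose every vertex rule, evaluated on basis fields, FACTORS OVER ITS LEGS after a finite sum over LABELS `ξ ∈ Ξ_i`
(the vertex's position together with its internal channels, bond direction, …): `V_i(b∘a) = Σ_ξ ū_i(ξ) · Π_j σ_ij(ξ, a_j)` with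
SIGNED leg weights `σ` — for a leg attached by a Kronecker delta `σ = [a = (x,c)]`, for a DIFFERENTIATED leg of (1.8)/(1.9)
`σ(ξ, p) = ⟨(D_B̃ δ_p)(b), T e_c⟩` (the covariant difference quotient, sign and gauge factor included).  Then the sum over index
assignments factorizes line by line (FILE 12 §1 `sum_assign_factor`) and the expression of the graph is THE SUM OVER THE LABELS OF THE
VERTICES of the product of the vertex coefficients, the external components contracted against the external legs' weights, and
ONE SIGNED EFFECTIVE KERNEL PER LINE, `k_l(ξ, ξ′) = Σ_{p,p′} σ_l(ξ,p) σ_{l′}(ξ′,p′) K_l(p,p′)` — for a line at a differentiated leg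
this is the covariant difference quotient OF THE PROPAGATOR in that variable (FILE 6's `dK1`/`dK2`, FILE 5's `dKs` when both ends
are differentiated), which is what (2.11) bounds: *"if the propagator is differentiated, then for each differentiation, there is an
additional factor (L^jη)⁻¹ on the right side"*. [cite: Balaban1983Higgs3, (2.11) p.426] [cite: Balaban1983Higgs3, p.420] -/
theorem amp_eq_labelForm (V : Rules G SF VF OF) (bS : IS → SF) (bV : IV → VF) (bO : IO → OF) (Po : OutPairing G)
    (Ks : SLine G → IS → IS → ℝ) (Kv : VLine G → IV → IV → ℝ) (Ko : Po.Line oRank → IO → IO → ℝ)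
    (Φ : (ExtSLeg G → IS) → ℝ) (A : (ExtVLeg G → IV) → ℝ) (Ψ : (Po.Ext → IO) → ℝ)
    {Ξ : Fin G.nV → Type*} [∀ i, Fintype (Ξ i)] (ub : (i : Fin G.nV) → Ξ i → ℝ)
    (σS : (ℓ : SLeg G.kind) → Ξ ℓ.1 → IS → ℝ) (σV : (ℓ : VLeg G.kind) → Ξ ℓ.1 → IV → ℝ)
    (σO : (ℓ : OLeg G.kind) → Ξ ℓ.1 → IO → ℝ)
    (hV : ∀ (i : Fin G.nV) (aS : Fin (G.kind i).scalarLegs → IS) (aV : Fin (G.kind i).vectorLegs → IV)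
      (aO : Fin (outSlots (G.kind i)) → IO),
      V i (fun j => bS (aS j)) (fun j => bV (aV j)) (fun j => bO (aO j)) =
        ∑ ξ : Ξ i, ub i ξ * ((∏ j, σS ⟨i, j⟩ ξ (aS j)) * (∏ j, σV ⟨i, j⟩ ξ (aV j)) * ∏ j, σO ⟨i, j⟩ ξ (aO j))) :
    amp V bS bV bO Po Ks Kv Ko Φ A Ψ =
      ∑ ξ : (i : Fin G.nV) → Ξ i, (∏ i, ub i (ξ i)) *
        (((∑ γ : ExtSLeg G → IS, (∏ e : ExtSLeg G, σS e.1 (ξ e.1.1) (γ e)) * Φ γ) *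
            ∏ l : SLine G, ∑ p, ∑ p', σS l.1 (ξ l.1.1) p * σS ((sPairing G).mate l.1) (ξ ((sPairing G).mate l.1).1) p' *
              Ks l p p') *
          ((∑ ζ : ExtVLeg G → IV, (∏ e : ExtVLeg G, σV e.1 (ξ e.1.1) (ζ e)) * A ζ) *
            ∏ l : VLine G, ∑ b, ∑ b', σV l.1 (ξ l.1.1) b * σV ((vPairing G).mate l.1) (ξ ((vPairing G).mate l.1).1) b' *
              Kv l b b') *
          ((∑ ο : Po.Ext → IO, (∏ e : Po.Ext, σO e.1 (ξ e.1.1) (ο e)) * Ψ ο) *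
            ∏ l : Po.Line oRank, ∑ r, ∑ r', σO l.1 (ξ l.1.1) r * σO (Po.mate l.1) (ξ (Po.mate l.1).1) r' * Ko l r r')) := by
  classical
  /- the vertex factor at an assignment, in label form -/
  have hvf : ∀ (α : SLeg G.kind → IS) (β : VLeg G.kind → IV) (ο : OLeg G.kind → IO),
      vertexFactor V bS bV bO α β ο = ∑ ξ : (i : Fin G.nV) → Ξ i, (∏ i, ub i (ξ i)) *
        ((∏ ℓ : SLeg G.kind, σS ℓ (ξ ℓ.1) (α ℓ)) * (∏ ℓ : VLeg G.kind, σV ℓ (ξ ℓ.1) (β ℓ)) *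
          ∏ ℓ : OLeg G.kind, σO ℓ (ξ ℓ.1) (ο ℓ)) := by
    intro α β ο
    unfold vertexFactor
    rw [Finset.prod_congr rfl fun i _ => hV i (fun j => α ⟨i, j⟩) (fun j => β ⟨i, j⟩) (fun j => ο ⟨i, j⟩)]
    rw [Fintype.prod_sum (fun i ξ => ub i ξ * ((∏ j, σS ⟨i, j⟩ ξ (α ⟨i, j⟩)) * (∏ j, σV ⟨i, j⟩ ξ (β ⟨i, j⟩)) *
      ∏ j, σO ⟨i, j⟩ ξ (ο ⟨i, j⟩)))]
    refine Finset.sum_congr rfl fun ξ _ => ?_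
    rw [Finset.prod_mul_distrib, Finset.prod_mul_distrib, Finset.prod_mul_distrib,
      prod_sigma_univ (fun ℓ : SLeg G.kind => σS ℓ (ξ ℓ.1) (α ℓ)),
      prod_sigma_univ (fun ℓ : VLeg G.kind => σV ℓ (ξ ℓ.1) (β ℓ)),
      prod_sigma_univ (fun ℓ : OLeg G.kind => σO ℓ (ξ ℓ.1) (ο ℓ))]
  /- one summand of `amp` in label form -/
  have hterm : ∀ (α : SLeg G.kind → IS) (β : VLeg G.kind → IV) (ο : OLeg G.kind → IO),
      vertexFactor V bS bV bO α β ο * (Φ (fun ℓ => α ℓ.1) * A (fun ℓ => β ℓ.1) * Ψ (fun ℓ => ο ℓ.1)) *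
          (sLineFactor Ks α * vLineFactor Kv β * oLineFactor Po Ko ο) =
        ∑ ξ : (i : Fin G.nV) → Ξ i, (∏ i, ub i (ξ i)) *
          (((∏ ℓ : SLeg G.kind, σS ℓ (ξ ℓ.1) (α ℓ)) * Φ (fun e => α e.1) *
              ∏ l : SLine G, Ks l (α l.1) (α ((sPairing G).mate l.1))) *
            ((∏ ℓ : VLeg G.kind, σV ℓ (ξ ℓ.1) (β ℓ)) * A (fun e => β e.1) *
              ∏ l : VLine G, Kv l (β l.1) (β ((vPairing G).mate l.1))) *
            ((∏ ℓ : OLeg G.kind, σO ℓ (ξ ℓ.1) (ο ℓ)) * Ψ (fun e => ο e.1) *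
              ∏ l : Po.Line oRank, Ko l (ο l.1) (ο (Po.mate l.1)))) := by
    intro α β ο
    rw [hvf, Finset.sum_mul, Finset.sum_mul]
    refine Finset.sum_congr rfl fun ξ _ => ?_
    simp only [sLineFactor, vLineFactor, oLineFactor]
    ring
  unfold amp
  rw [show (∑ α : SLeg G.kind → IS, ∑ β : VLeg G.kind → IV, ∑ ο : OLeg G.kind → IO,
      vertexFactor V bS bV bO α β ο * (Φ (fun ℓ => α ℓ.1) * A (fun ℓ => β ℓ.1) * Ψ (fun ℓ => ο ℓ.1)) *
        (sLineFactor Ks α * vLineFactor Kv β * oLineFactor Po Ko ο)) =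
      ∑ α : SLeg G.kind → IS, ∑ β : VLeg G.kind → IV, ∑ ο : OLeg G.kind → IO,
        ∑ ξ : (i : Fin G.nV) → Ξ i, (∏ i, ub i (ξ i)) *
          (((∏ ℓ : SLeg G.kind, σS ℓ (ξ ℓ.1) (α ℓ)) * Φ (fun e => α e.1) *
              ∏ l : SLine G, Ks l (α l.1) (α ((sPairing G).mate l.1))) *
            ((∏ ℓ : VLeg G.kind, σV ℓ (ξ ℓ.1) (β ℓ)) * A (fun e => β e.1) *
              ∏ l : VLine G, Kv l (β l.1) (β ((vPairing G).mate l.1))) *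
            ((∏ ℓ : OLeg G.kind, σO ℓ (ξ ℓ.1) (ο ℓ)) * Ψ (fun e => ο e.1) *
              ∏ l : Po.Line oRank, Ko l (ο l.1) (ο (Po.mate l.1)))) from
    Finset.sum_congr rfl fun α _ => Finset.sum_congr rfl fun β _ => Finset.sum_congr rfl fun ο _ => hterm α β ο]
  rw [sum3_sum_comm]
  refine Finset.sum_congr rfl fun ξ _ => ?_
  rw [sum3_const_mul, sum3_mul,
    sum_assign_factor (sPairing G) sRank sRank_injective Φ (fun ℓ p => σS ℓ (ξ ℓ.1) p) (fun l p p' => Ks l p p'),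
    sum_assign_factor (vPairing G) vRank vRank_injective A (fun ℓ b => σV ℓ (ξ ℓ.1) b) (fun l b b' => Kv l b b'),
    sum_assign_factor Po oRank oRank_injective Ψ (fun ℓ r => σO ℓ (ξ ℓ.1) r) (fun l r r' => Ko l r r')]

/-- **THE FIRST ESTIMATE IN SIGNED POSITION FORM** (p. 426, with each differentiation booked on its line as print does): in the
label form of `amp_eq_labelForm` take absolute values, bound each signed effective line kernel by a POSITION KERNEL of the
positions `pos(ξ), pos(ξ′)` of its endpoints' labels — `|k_l(ξ, ξ′)| ≤ K̄_l(pos ξ, pos ξ′)`, where for a line at a differentiated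
leg `K̄_l` is fed by (2.10) WITH the factor `(L^jη)⁻¹` of (2.11) (a bound on `D G_{(j)}` itself, not `η⁻¹·|G_{(j)}|`) — the external
contractions by per-leg data `Π_e n_e(pos ξ_{v(e)})`, and re-sum the labels over the fibres of `pos`: with
`Σ_{ξ ↦ x} |ū_i(ξ)| ≤ U_i(x)` the expression is dominated by `Σ_{x : V(G) → X} Π_i U_i(x_i) · Π_e n_e · Π_l K̄_l(x_{v_l}, x_{v′_l})`,
THE SAME SHAPE as FILE 12 §2's `abs_amp_le_positionForm` (so FILE 12 §6's `positionForm_eq_lines` and §7's `ampOf` apply verbatim), but now the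
vertex functions carry no `η⁻¹` for the difference quotients — those sit in the line bounds, as in (2.14)'s `W(𝔾(j))` and p19's
`B3Ineq213Amplitude.Amp` (`a_l`: −1 per differentiation; `e_v ≥ 0`). [cite: Balaban1983Higgs3, (2.13) p.426]
[cite: Balaban1983Higgs3, (2.11) p.426] [cite: Balaban1983Higgs3, (2.14) p.427] -/
theorem abs_amp_le_positionForm_signed [DecidableEq X] (V : Rules G SF VF OF) (bS : IS → SF) (bV : IV → VF) (bO : IO → OF)
    (Po : OutPairing G) (Ks : SLine G → IS → IS → ℝ) (Kv : VLine G → IV → IV → ℝ) (Ko : Po.Line oRank → IO → IO → ℝ)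
    (Φ : (ExtSLeg G → IS) → ℝ) (A : (ExtVLeg G → IV) → ℝ) (Ψ : (Po.Ext → IO) → ℝ)
    {Ξ : Fin G.nV → Type*} [∀ i, Fintype (Ξ i)] (ub : (i : Fin G.nV) → Ξ i → ℝ)
    (σS : (ℓ : SLeg G.kind) → Ξ ℓ.1 → IS → ℝ) (σV : (ℓ : VLeg G.kind) → Ξ ℓ.1 → IV → ℝ)
    (σO : (ℓ : OLeg G.kind) → Ξ ℓ.1 → IO → ℝ)
    (hV : ∀ (i : Fin G.nV) (aS : Fin (G.kind i).scalarLegs → IS) (aV : Fin (G.kind i).vectorLegs → IV)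
      (aO : Fin (outSlots (G.kind i)) → IO),
      V i (fun j => bS (aS j)) (fun j => bV (aV j)) (fun j => bO (aO j)) =
        ∑ ξ : Ξ i, ub i ξ * ((∏ j, σS ⟨i, j⟩ ξ (aS j)) * (∏ j, σV ⟨i, j⟩ ξ (aV j)) * ∏ j, σO ⟨i, j⟩ ξ (aO j)))
    (pos : (i : Fin G.nV) → Ξ i → X) (U : Fin G.nV → X → ℝ)
    (hU : ∀ i x, ∑ ξ : Ξ i, (if pos i ξ = x then |ub i ξ| else 0) ≤ U i x)
    (KS : SLine G → X → X → ℝ) (hKS0 : ∀ l x x', 0 ≤ KS l x x')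
    (hKs : ∀ (l : SLine G) (ξ₁ : Ξ l.1.1) (ξ₂ : Ξ ((sPairing G).mate l.1).1),
      |∑ p, ∑ p', σS l.1 ξ₁ p * σS ((sPairing G).mate l.1) ξ₂ p' * Ks l p p'| ≤ KS l (pos _ ξ₁) (pos _ ξ₂))
    (KV : VLine G → X → X → ℝ) (hKV0 : ∀ l x x', 0 ≤ KV l x x')
    (hKv : ∀ (l : VLine G) (ξ₁ : Ξ l.1.1) (ξ₂ : Ξ ((vPairing G).mate l.1).1),
      |∑ b, ∑ b', σV l.1 ξ₁ b * σV ((vPairing G).mate l.1) ξ₂ b' * Kv l b b'| ≤ KV l (pos _ ξ₁) (pos _ ξ₂))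
    (KO : Po.Line oRank → X → X → ℝ) (hKO0 : ∀ l x x', 0 ≤ KO l x x')
    (hKo : ∀ (l : Po.Line oRank) (ξ₁ : Ξ l.1.1) (ξ₂ : Ξ (Po.mate l.1).1),
      |∑ r, ∑ r', σO l.1 ξ₁ r * σO (Po.mate l.1) ξ₂ r' * Ko l r r'| ≤ KO l (pos _ ξ₁) (pos _ ξ₂))
    (nS : ExtSLeg G → X → ℝ) (hnS0 : ∀ e x, 0 ≤ nS e x)
    (hΦ : ∀ ξ : (i : Fin G.nV) → Ξ i,
      |∑ γ : ExtSLeg G → IS, (∏ e : ExtSLeg G, σS e.1 (ξ e.1.1) (γ e)) * Φ γ| ≤ ∏ e : ExtSLeg G, nS e (pos _ (ξ e.1.1)))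
    (nV : ExtVLeg G → X → ℝ) (hnV0 : ∀ e x, 0 ≤ nV e x)
    (hA : ∀ ξ : (i : Fin G.nV) → Ξ i,
      |∑ ζ : ExtVLeg G → IV, (∏ e : ExtVLeg G, σV e.1 (ξ e.1.1) (ζ e)) * A ζ| ≤ ∏ e : ExtVLeg G, nV e (pos _ (ξ e.1.1)))
    (nO : Po.Ext → X → ℝ) (hnO0 : ∀ e x, 0 ≤ nO e x)
    (hΨ : ∀ ξ : (i : Fin G.nV) → Ξ i,
      |∑ ο : Po.Ext → IO, (∏ e : Po.Ext, σO e.1 (ξ e.1.1) (ο e)) * Ψ ο| ≤ ∏ e : Po.Ext, nO e (pos _ (ξ e.1.1))) :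
    |amp V bS bV bO Po Ks Kv Ko Φ A Ψ| ≤
      ∑ x : Fin G.nV → X, (∏ i, U i (x i)) *
        (((∏ e : ExtSLeg G, nS e (x e.1.1)) * ∏ l : SLine G, KS l (x l.1.1) (x ((sPairing G).mate l.1).1)) *
          ((∏ e : ExtVLeg G, nV e (x e.1.1)) * ∏ l : VLine G, KV l (x l.1.1) (x ((vPairing G).mate l.1).1)) *
          ((∏ e : Po.Ext, nO e (x e.1.1)) * ∏ l : Po.Line oRank, KO l (x l.1.1) (x (Po.mate l.1).1))) := by
  classical
  rw [amp_eq_labelForm V bS bV bO Po Ks Kv Ko Φ A Ψ ub σS σV σO hV]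
  /- the position-form weight of a position tuple -/
  set R : (Fin G.nV → X) → ℝ := fun x =>
    ((∏ e : ExtSLeg G, nS e (x e.1.1)) * ∏ l : SLine G, KS l (x l.1.1) (x ((sPairing G).mate l.1).1)) *
      ((∏ e : ExtVLeg G, nV e (x e.1.1)) * ∏ l : VLine G, KV l (x l.1.1) (x ((vPairing G).mate l.1).1)) *
      ((∏ e : Po.Ext, nO e (x e.1.1)) * ∏ l : Po.Line oRank, KO l (x l.1.1) (x (Po.mate l.1).1)) with hR
  have hR0 : ∀ x, 0 ≤ R x := fun x => by
    rw [hR]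
    exact mul_nonneg (mul_nonneg (mul_nonneg (Finset.prod_nonneg fun e _ => hnS0 _ _)
      (Finset.prod_nonneg fun l _ => hKS0 _ _ _)) (mul_nonneg (Finset.prod_nonneg fun e _ => hnV0 _ _)
      (Finset.prod_nonneg fun l _ => hKV0 _ _ _))) (mul_nonneg (Finset.prod_nonneg fun e _ => hnO0 _ _)
      (Finset.prod_nonneg fun l _ => hKO0 _ _ _))
  /- termwise: |label summand| ≤ Π |ū| · R(pos ∘ ξ) -/
  have hterm : ∀ ξ : (i : Fin G.nV) → Ξ i,
      |(∏ i, ub i (ξ i)) *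
        (((∑ γ : ExtSLeg G → IS, (∏ e : ExtSLeg G, σS e.1 (ξ e.1.1) (γ e)) * Φ γ) *
            ∏ l : SLine G, ∑ p, ∑ p', σS l.1 (ξ l.1.1) p * σS ((sPairing G).mate l.1) (ξ ((sPairing G).mate l.1).1) p' *
              Ks l p p') *
          ((∑ ζ : ExtVLeg G → IV, (∏ e : ExtVLeg G, σV e.1 (ξ e.1.1) (ζ e)) * A ζ) *
            ∏ l : VLine G, ∑ b, ∑ b', σV l.1 (ξ l.1.1) b * σV ((vPairing G).mate l.1) (ξ ((vPairing G).mate l.1).1) b' *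
              Kv l b b') *
          ((∑ ο : Po.Ext → IO, (∏ e : Po.Ext, σO e.1 (ξ e.1.1) (ο e)) * Ψ ο) *
            ∏ l : Po.Line oRank, ∑ r, ∑ r', σO l.1 (ξ l.1.1) r * σO (Po.mate l.1) (ξ (Po.mate l.1).1) r' * Ko l r r'))| ≤
        (∏ i, |ub i (ξ i)|) * R (fun i => pos i (ξ i)) := by
    intro ξ
    rw [abs_mul, Finset.abs_prod]
    refine mul_le_mul_of_nonneg_left ?_ (Finset.prod_nonneg fun i _ => abs_nonneg _)
    rw [hR, abs_mul, abs_mul]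
    have hS : |(∑ γ : ExtSLeg G → IS, (∏ e : ExtSLeg G, σS e.1 (ξ e.1.1) (γ e)) * Φ γ) *
          ∏ l : SLine G, ∑ p, ∑ p', σS l.1 (ξ l.1.1) p * σS ((sPairing G).mate l.1) (ξ ((sPairing G).mate l.1).1) p' *
            Ks l p p'| ≤
        (∏ e : ExtSLeg G, nS e (pos _ (ξ e.1.1))) * ∏ l : SLine G, KS l (pos _ (ξ l.1.1)) (pos _ (ξ ((sPairing G).mate l.1).1)) := by
      rw [abs_mul, Finset.abs_prod]
      exact mul_le_mul (hΦ ξ) (Finset.prod_le_prod (fun l _ => abs_nonneg _) fun l _ => hKs l _ _)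
        (Finset.prod_nonneg fun l _ => abs_nonneg _) (Finset.prod_nonneg fun e _ => hnS0 _ _)
    have hVv : |(∑ ζ : ExtVLeg G → IV, (∏ e : ExtVLeg G, σV e.1 (ξ e.1.1) (ζ e)) * A ζ) *
          ∏ l : VLine G, ∑ b, ∑ b', σV l.1 (ξ l.1.1) b * σV ((vPairing G).mate l.1) (ξ ((vPairing G).mate l.1).1) b' *
            Kv l b b'| ≤
        (∏ e : ExtVLeg G, nV e (pos _ (ξ e.1.1))) * ∏ l : VLine G, KV l (pos _ (ξ l.1.1)) (pos _ (ξ ((vPairing G).mate l.1).1)) := by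
      rw [abs_mul, Finset.abs_prod]
      exact mul_le_mul (hA ξ) (Finset.prod_le_prod (fun l _ => abs_nonneg _) fun l _ => hKv l _ _)
        (Finset.prod_nonneg fun l _ => abs_nonneg _) (Finset.prod_nonneg fun e _ => hnV0 _ _)
    have hO : |(∑ ο : Po.Ext → IO, (∏ e : Po.Ext, σO e.1 (ξ e.1.1) (ο e)) * Ψ ο) *
          ∏ l : Po.Line oRank, ∑ r, ∑ r', σO l.1 (ξ l.1.1) r * σO (Po.mate l.1) (ξ (Po.mate l.1).1) r' * Ko l r r'| ≤
        (∏ e : Po.Ext, nO e (pos _ (ξ e.1.1))) * ∏ l : Po.Line oRank, KO l (pos _ (ξ l.1.1)) (pos _ (ξ (Po.mate l.1).1)) := by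
      rw [abs_mul, Finset.abs_prod]
      exact mul_le_mul (hΨ ξ) (Finset.prod_le_prod (fun l _ => abs_nonneg _) fun l _ => hKo l _ _)
        (Finset.prod_nonneg fun l _ => abs_nonneg _) (Finset.prod_nonneg fun e _ => hnO0 _ _)
    exact mul_le_mul (mul_le_mul hS hVv (abs_nonneg _) ((abs_nonneg _).trans hS)) hO (abs_nonneg _)
      (mul_nonneg ((abs_nonneg _).trans hS) ((abs_nonneg _).trans hVv))
  refine (Finset.abs_sum_le_sum_abs _ _).trans ((Finset.sum_le_sum fun ξ _ => hterm ξ).trans ?_)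
  /- re-summation over the fibres of `pos` -/
  rw [← Finset.sum_fiberwise (s := (Finset.univ : Finset ((i : Fin G.nV) → Ξ i))) (g := fun ξ i => pos i (ξ i))
    (f := fun ξ => (∏ i, |ub i (ξ i)|) * R (fun i => pos i (ξ i)))]
  refine Finset.sum_le_sum fun x _ => ?_
  have hfib : ∑ ξ ∈ (Finset.univ : Finset ((i : Fin G.nV) → Ξ i)).filter (fun ξ => (fun i => pos i (ξ i)) = x),
      (∏ i, |ub i (ξ i)|) * R (fun i => pos i (ξ i)) =
      (∑ ξ ∈ (Finset.univ : Finset ((i : Fin G.nV) → Ξ i)).filter (fun ξ => (fun i => pos i (ξ i)) = x),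
        ∏ i, |ub i (ξ i)|) * R x := by
    rw [Finset.sum_mul]
    refine Finset.sum_congr rfl fun ξ hξ => ?_
    rw [(Finset.mem_filter.1 hξ).2]
  rw [hfib, sum_filter_proj_eq_prod pos (fun i ζ => |ub i ζ|) x]
  refine le_of_le_of_eq (mul_le_mul_of_nonneg_right ?_ (hR0 x)) rfl
  refine Finset.prod_le_prod (fun i _ => Finset.sum_nonneg fun ζ _ => abs_nonneg _) fun i _ => ?_
  rw [Finset.sum_filter]
  exact hU i (x i)

end LabelForm

/-! ## §2 SIGNED attachments of the legs and the signed effective line kernels (`dK1`, `dK2`, `dKs`) -/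

section SignedAttach

variable {P : HiggsLattice.Params} {N k : ℕ}

open Literature.MathematicalPhysics.QuantumFieldTheory.Balaban1983to89.HiggsLattice (ChargeData covDeriv)
open Literature.MathematicalPhysics.QuantumFieldTheory.Balaban1983to89.B3Prop1 (VertexKind)
open Literature.MathematicalPhysics.QuantumFieldTheory.Balaban1983to89.B3Eq36TadpoleExpressions (basisE_eq)
open Literature.MathematicalPhysics.QuantumFieldTheory.Balaban1983to89.B3Eq39FromFeynmanRules (dKs)
open Literature.MathematicalPhysics.QuantumFieldTheory.Balaban1983to89.B3Eq326FromFeynmanRules (dK1 dK2)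
open Literature.MathematicalPhysics.QuantumFieldTheory.Balaban1983to89.HiggsAveraging (blockK blockIter)
open Literature.MathematicalPhysics.QuantumFieldTheory.Balaban1983to89.B3VertexTensorBounds (taylorRemOp)
open Literature.MathematicalPhysics.QuantumFieldTheory.Balaban1983to89.B3Eq18VertexExpansion (remTensor)
open Literature.MathematicalPhysics.QuantumFieldTheory.Balaban1983to89.B3Eq114AveragingVertices (vertex113)

/-- The SIGNED attachment of an undifferentiated φ′-leg at the site `x` with internal channel `c`: `[p = (x, c)]` (the component
`(δ_p(x))_c`). [cite: Balaban1983Higgs3, p.414] -/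
def sigS (x : HiggsLattice.Site P 0) (c : Fin N) (p : HiggsLattice.Site P 0 × Fin N) : ℝ := if p = (x, c) then 1 else 0

/-- The SIGNED attachment of a DIFFERENTIATED φ′-leg of (1.8)/(1.9) at the bond `b` with channel `c`: the component
`((D^η_B̃ δ_p)(b))_c = η⁻¹([p.1 = b₊](U(B̃_b) e_{p.2})_c − [p.1 = b₋][p.2 = c])` — sign and gauge factor kept, NO absolute value.
[cite: Balaban1983Higgs3, (1.8) p.413] [cite: Balaban1982Higgs1, (1.7) p.605] -/
def sigD (C : ChargeData N) (B : HiggsLattice.VecField P 0) (b : HiggsLattice.PBond P 0) (c : Fin N)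
    (p : HiggsLattice.Site P 0 × Fin N) : ℝ :=
  covDeriv C B (basisE p) b c

/-- The signed attachment of an A′-leg of a bond vertex at the bond `b`: `[β = b]` (`= δ_β(b)`). [cite: Balaban1983Higgs3, (1.8) p.413] -/
def sigB [DecidableEq (HiggsLattice.PBond P 0)] (b β : HiggsLattice.PBond P 0) : ℝ := if β = b then 1 else 0

/-- The signed attachment of the output of an averaging vertex at the block point `y` with channel `c`: `[r = (y, c)]`.
[cite: Balaban1983Higgs3, (1.13) p.413] -/
def sigO (y : HiggsLattice.Site P k) (c : Fin N) (r : HiggsLattice.Site P k × Fin N) : ℝ := if r = (y, c) then 1 else 0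

/-- Collapsing a channel sum against `sigS`: `Σ_c [p = (x,c)] f(c) = [p.1 = x] f(p.2)`. [cite: Balaban1983Higgs3, p.414] -/
theorem sum_sigS_mul (x : HiggsLattice.Site P 0) (p : HiggsLattice.Site P 0 × Fin N) (f : Fin N → ℝ) :
    ∑ c, sigS x c p * f c = if p.1 = x then f p.2 else 0 := by
  obtain ⟨x₁, a⟩ := p
  unfold sigS
  by_cases h : x₁ = x
  · subst h
    simp [Prod.ext_iff]
  · simp [Prod.ext_iff, h]

/-- Collapsing the full position-and-channel sum against `sigS`: exactly one term. [cite: Balaban1983Higgs3, p.414] -/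
theorem sum2_sigS_mul (p : HiggsLattice.Site P 0 × Fin N) (f : HiggsLattice.Site P 0 → Fin N → ℝ) :
    ∑ x, ∑ c, sigS x c p * f x c = f p.1 p.2 := by
  simp only [sum_sigS_mul]
  simp

/-- Collapsing a channel sum against `sigO`. [cite: Balaban1983Higgs3, (1.13) p.413] -/
theorem sum_sigO_mul (y : HiggsLattice.Site P k) (r : HiggsLattice.Site P k × Fin N) (f : Fin N → ℝ) :
    ∑ c, sigO y c r * f c = if r.1 = y then f r.2 else 0 := by
  obtain ⟨y₁, a⟩ := r
  unfold sigO
  by_cases h : y₁ = y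
  · subst h
    simp [Prod.ext_iff]
  · simp [Prod.ext_iff, h]

/-- Collapsing a bond sum against `sigB`. [cite: Balaban1983Higgs3, (1.8) p.413] -/
theorem sum_sigB_mul [DecidableEq (HiggsLattice.PBond P 0)] (b : HiggsLattice.PBond P 0) (f : HiggsLattice.PBond P 0 → ℝ) : ∑ β, sigB b β * f β = f b := by
  unfold sigB
  simp only [ite_mul, one_mul, zero_mul]
  rw [Finset.sum_ite_eq']
  simp

/-- The basis field at a site of ANY level paired with a vector: `δ_r(y)·v = [y = r.1] v_{r.2}`. [cite: Balaban1983Higgs3, p.414] -/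
theorem inner_basisE_left' {j : ℕ} (r : HiggsLattice.Site P j × Fin N) (y : HiggsLattice.Site P j) (v : HiggsCovariance.E N) :
    inner ℝ (basisE r y) v = if y = r.1 then v r.2 else 0 := by
  rw [basisE_eq]
  by_cases h : y = r.1
  · rw [if_pos h, if_pos h, EuclideanSpace.inner_single_left]
    simp
  · rw [if_neg h, if_neg h, inner_zero_left]

/-- A vector paired with a basis vector of the internal space: `v·e_c = v_c`. [folklore] -/
private theorem inner_single_right' (v : HiggsCovariance.E N) (c : Fin N) :
    inner ℝ v (EuclideanSpace.single c (1 : ℝ)) = v c := by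
  rw [EuclideanSpace.inner_single_right]
  simp

/-- The real Euclidean scalar product in components. [folklore] -/
private theorem inner_eq_sum_mul (v w : HiggsCovariance.E N) : inner ℝ v w = ∑ c, v c * w c := by
  rw [PiLp.inner_apply]
  simp only [RCLike.inner_apply, conj_trivial]
  exact Finset.sum_congr rfl fun c _ => mul_comm _ _

/-- **A site bracket with an operator on basis fields, in SIGNED channel form**: `(δ_p(x))·T(δ_q(x)) = Σ_{c,c′} [p=(x,c)][q=(x,c′)]
(T e_{c′})_c` — the vertex's channel tensor `(T e_{c′})_c` (`δ_{cc′}` for `T = 1`, `(q^m)_{cc′}` for (1.10)) between two delta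
attachments. [cite: Balaban1983Higgs3, (1.6) p.413] [cite: Balaban1983Higgs3, (1.10) p.413] -/
theorem inner_basisE_op_basisE (T : HiggsCovariance.E N →L[ℝ] HiggsCovariance.E N) (p q : HiggsLattice.Site P 0 × Fin N)
    (x : HiggsLattice.Site P 0) :
    inner ℝ (basisE p x) (T (basisE q x)) = ∑ c, ∑ c', sigS x c p * sigS x c' q * T (EuclideanSpace.single c' (1 : ℝ)) c := by
  have hR : ∑ c, ∑ c', sigS x c p * sigS x c' q * T (EuclideanSpace.single c' (1 : ℝ)) c =
      ∑ c, sigS x c p * ∑ c', sigS x c' q * T (EuclideanSpace.single c' (1 : ℝ)) c := by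
    refine Finset.sum_congr rfl fun c _ => ?_
    rw [Finset.mul_sum]
    exact Finset.sum_congr rfl fun c' _ => by ring
  rw [hR]
  rw [Finset.sum_congr rfl fun c _ => by rw [sum_sigS_mul x q], sum_sigS_mul x p]
  rw [basisE_eq q, inner_basisE_left']
  by_cases hp : x = p.1
  · by_cases hq : x = q.1
    · rw [if_pos hq, if_pos hp, if_pos hp.symm, if_pos hq.symm]
    · have hq' : ¬q.1 = x := fun h => hq h.symm
      rw [if_neg hq, if_pos hp, if_pos hp.symm, if_neg hq', map_zero]
      rfl
  · have hp' : ¬p.1 = x := fun h => hp h.symm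
    rw [if_neg hp, if_neg hp']

/-- **The DIFFERENTIATED bracket of (1.8)/(1.9) on basis fields, in signed channel form**:
`(D^η_B̃ δ_p)(b)·T(δ_q(b₋)) = Σ_{c,c′} ((D_B̃ δ_p)(b))_c · [q = (b₋,c′)] · (T e_{c′})_c`. [cite: Balaban1983Higgs3, (1.8) p.413] -/
theorem inner_covDeriv_basisE_op_basisE (C : ChargeData N) (B : HiggsLattice.VecField P 0)
    (T : HiggsCovariance.E N →L[ℝ] HiggsCovariance.E N) (p q : HiggsLattice.Site P 0 × Fin N) (b : HiggsLattice.PBond P 0) :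
    inner ℝ (covDeriv C B (basisE p) b) (T (basisE q b.src)) =
      ∑ c, ∑ c', sigD C B b c p * sigS b.src c' q * T (EuclideanSpace.single c' (1 : ℝ)) c := by
  have hR : ∑ c, ∑ c', sigD C B b c p * sigS b.src c' q * T (EuclideanSpace.single c' (1 : ℝ)) c =
      ∑ c, sigD C B b c p * ∑ c', sigS b.src c' q * T (EuclideanSpace.single c' (1 : ℝ)) c := by
    refine Finset.sum_congr rfl fun c _ => ?_
    rw [Finset.mul_sum]
    exact Finset.sum_congr rfl fun c' _ => by ring
  rw [hR]
  rw [Finset.sum_congr rfl fun c _ => by rw [sum_sigS_mul b.src q]]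
  rw [basisE_eq q]
  by_cases hq : b.src = q.1
  · have hq' : q.1 = b.src := hq.symm
    rw [if_pos hq]
    simp only [hq', if_true]
    rw [inner_eq_sum_mul]
    rfl
  · have hq' : ¬q.1 = b.src := fun h => hq h.symm
    rw [if_neg hq, map_zero, inner_zero_right]
    simp only [hq', if_false, mul_zero, Finset.sum_const_zero]

/-- **The polarized A′-legs of a bond vertex on basis bond fields**: `Π_j g(b₋)δ_{β_j}(b) = g(b₋)^n Π_j [β_j = b]`.
[cite: Balaban1983Higgs3, (1.8) p.413] -/
theorem vlegs_basisV [DecidableEq (HiggsLattice.PBond P 0)] (g : HiggsLattice.Site P 0 → ℝ) {n : ℕ} (aV : Fin n → HiggsLattice.PBond P 0) (b : HiggsLattice.PBond P 0) :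
    vlegs g (fun j => basisV (aV j)) b = g b.src ^ n * ∏ j, sigB b (aV j) := by
  unfold vlegs
  rw [Finset.prod_mul_distrib, Finset.prod_const, Finset.card_univ, Fintype.card_fin]
  congr 1
  refine Finset.prod_congr rfl fun j _ => ?_
  show basisV (aV j) b = sigB b (aV j)
  unfold basisV sigB
  by_cases h : b = aV j
  · rw [if_pos h, if_pos h.symm]
  · rw [if_neg h, if_neg (fun h' => h h'.symm)]

/-- **An averaging vertex read on basis fields, in signed channel form**: for per-site operators `Op_x` (the (1.13)–(1.15)
brackets `−w·(…)·U(B̃(Γ_{y,x}))`), `Σ_{y∈Y} w_Y(y) δ_r(y)·(Σ_{x∈B^k(y)} Op_x δ_p(x)) =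
Σ_{x,c,c′} [x^{(k)}∈Y] w_Y(x^{(k)}) (Op_x e_c)_{c′} · [p = (x,c)] · [r = (x^{(k)}, c′)]` — the φ′-leg at the fine site, the output at
its block point. [cite: Balaban1983Higgs3, (1.13)–(1.15) pp.413–414] -/
theorem avg_basis_labelForm (Op : HiggsLattice.Site P 0 → (HiggsCovariance.E N →L[ℝ] HiggsCovariance.E N))
    (Y : Finset (HiggsLattice.Site P k)) (wY : HiggsLattice.Site P k → ℝ) (p : HiggsLattice.Site P 0 × Fin N)
    (r : HiggsLattice.Site P k × Fin N) :
    ∑ y ∈ Y, wY y * inner ℝ (basisE r y) (∑ x ∈ blockK k y, Op x (basisE p x)) =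
      ∑ x, ∑ c, ∑ c', ((if blockIter k x ∈ Y then wY (blockIter k x) else 0) *
          Op x (EuclideanSpace.single c (1 : ℝ)) c') * (sigS x c p * sigO (blockIter k x) c' r) := by
  classical
  /- the inner block sum picks the site of the leg -/
  have hblock : ∀ y : HiggsLattice.Site P k, ∑ x ∈ blockK k y, Op x (basisE p x) =
      if blockIter k p.1 = y then Op p.1 (EuclideanSpace.single p.2 (1 : ℝ)) else 0 := by
    intro y
    have h1 : ∀ x, Op x (basisE p x) = if x = p.1 then Op p.1 (EuclideanSpace.single p.2 (1 : ℝ)) else 0 := by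
      intro x
      rw [basisE_eq]
      by_cases h : x = p.1
      · subst h; simp
      · simp [h]
    simp only [h1]
    rw [Finset.sum_ite_eq']
    simp [blockK]
  simp only [hblock]
  /- the right side: collapse x, c against sigS, then c′ against sigO -/
  have hR : ∑ x, ∑ c, ∑ c', ((if blockIter k x ∈ Y then wY (blockIter k x) else 0) *
          Op x (EuclideanSpace.single c (1 : ℝ)) c') * (sigS x c p * sigO (blockIter k x) c' r) =
      ∑ x, ∑ c, sigS x c p * ∑ c', sigO (blockIter k x) c' r *
        ((if blockIter k x ∈ Y then wY (blockIter k x) else 0) *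
          Op x (EuclideanSpace.single c (1 : ℝ)) c') := by
    refine Finset.sum_congr rfl fun x _ => Finset.sum_congr rfl fun c _ => ?_
    rw [Finset.mul_sum]
    exact Finset.sum_congr rfl fun c' _ => by ring
  rw [hR, sum2_sigS_mul]
  rw [sum_sigO_mul]
  /- the left side: the y-sum picks the block point of the output -/
  simp only [inner_basisE_left']
  simp only [ite_mul, mul_ite, mul_zero]
  rw [Finset.sum_ite_eq' Y r.1]
  by_cases h1 : r.1 = blockIter k p.1
  · rw [if_pos h1, ← h1]
    by_cases h2 : r.1 ∈ Y
    · simp [h2]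
    · simp [h2]
  · have h1' : ¬blockIter k p.1 = r.1 := fun h => h1 h.symm
    rw [if_neg h1]
    simp [h1']

/-! ### The signed effective line kernels: contraction identities -/

/-- Two undifferentiated φ′-legs: the line's effective kernel is the ENTRY `K((x,c),(x′,c′))`. [cite: Balaban1983Higgs3, p.414] -/
theorem sum2_sigS_sigS (x x' : HiggsLattice.Site P 0) (c c' : Fin N)
    (K : HiggsLattice.Site P 0 × Fin N → HiggsLattice.Site P 0 × Fin N → ℝ) :
    ∑ p, ∑ p', sigS x c p * sigS x' c' p' * K p p' = K (x, c) (x', c') := by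
  unfold sigS
  simp only [ite_mul, one_mul, zero_mul, Finset.sum_ite_irrel, Finset.sum_const_zero, Finset.sum_ite_eq',
    Finset.mem_univ, if_true]

/-- A DIFFERENTIATED leg at the first endpoint, an undifferentiated one at the second: the effective kernel is FILE 6's
`dK1 K (b, e_c; (x′,c′)) = Σ_p K(p,(x′,c′))((D_B̃ δ_p)(b))_c` — the covariant difference quotient OF THE PROPAGATOR in its first
variable, which (2.11) bounds with the factor `(L^jη)⁻¹`. [cite: Balaban1983Higgs3, (2.11) p.426] [cite: Balaban1983Higgs3, (3.26) p.440] -/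
theorem sum2_sigD_sigS (C : ChargeData N) (B : HiggsLattice.VecField P 0) (b : HiggsLattice.PBond P 0) (c : Fin N)
    (x' : HiggsLattice.Site P 0) (c' : Fin N) (K : HiggsLattice.Site P 0 × Fin N → HiggsLattice.Site P 0 × Fin N → ℝ) :
    ∑ p, ∑ p', sigD C B b c p * sigS x' c' p' * K p p' = dK1 C B K b (EuclideanSpace.single c (1 : ℝ)) (x', c') := by
  unfold dK1 sigD
  refine Finset.sum_congr rfl fun p _ => ?_
  have h : ∑ p', covDeriv C B (basisE p) b c * sigS x' c' p' * K p p' =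
      covDeriv C B (basisE p) b c * ∑ p', sigS x' c' p' * K p p' := by
    rw [Finset.mul_sum]
    exact Finset.sum_congr rfl fun p' _ => by ring
  rw [h, inner_single_right']
  unfold sigS
  simp only [ite_mul, one_mul, zero_mul]
  rw [Finset.sum_ite_eq' Finset.univ (x', c')]
  simp [mul_comm]

/-- Undifferentiated at the first endpoint, DIFFERENTIATED at the second: FILE 6's `dK2 K ((x,c); b′, e_{c′})`.
[cite: Balaban1983Higgs3, (2.11) p.426] [cite: Balaban1983Higgs3, (3.26) p.440] -/
theorem sum2_sigS_sigD (C : ChargeData N) (B : HiggsLattice.VecField P 0) (x : HiggsLattice.Site P 0) (c : Fin N)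
    (b' : HiggsLattice.PBond P 0) (c' : Fin N) (K : HiggsLattice.Site P 0 × Fin N → HiggsLattice.Site P 0 × Fin N → ℝ) :
    ∑ p, ∑ p', sigS x c p * sigD C B b' c' p' * K p p' = dK2 C B K (x, c) b' (EuclideanSpace.single c' (1 : ℝ)) := by
  unfold dK2 sigD sigS
  simp only [ite_mul, one_mul, zero_mul, Finset.sum_ite_irrel, Finset.sum_const_zero, Finset.sum_ite_eq',
    Finset.mem_univ, if_true]
  refine Finset.sum_congr rfl fun p' _ => ?_
  rw [inner_single_right', mul_comm]

/-- DIFFERENTIATED at both endpoints: FILE 5's `dKs K (b, e_c; b′, e_{c′})` (print's `∂^η G ∂^{η*}` of (3.9)).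
[cite: Balaban1983Higgs3, (2.11) p.426] [cite: Balaban1983Higgs3, (3.9) p.435] -/
theorem sum2_sigD_sigD (C : ChargeData N) (B : HiggsLattice.VecField P 0) (b : HiggsLattice.PBond P 0) (c : Fin N)
    (b' : HiggsLattice.PBond P 0) (c' : Fin N) (K : HiggsLattice.Site P 0 × Fin N → HiggsLattice.Site P 0 × Fin N → ℝ) :
    ∑ p, ∑ p', sigD C B b c p * sigD C B b' c' p' * K p p' =
      dKs C B K b (EuclideanSpace.single c (1 : ℝ)) b' (EuclideanSpace.single c' (1 : ℝ)) := by
  unfold dKs sigD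
  refine Finset.sum_congr rfl fun p _ => Finset.sum_congr rfl fun p' _ => ?_
  rw [inner_single_right', inner_single_right']
  ring

/-- Two A′-legs of bond vertices: the entry `Kv(b, b′)`. [cite: Balaban1983Higgs3, p.414] -/
theorem sum2_sigB_sigB [DecidableEq (HiggsLattice.PBond P 0)] (b b' : HiggsLattice.PBond P 0) (Kv : HiggsLattice.PBond P 0 → HiggsLattice.PBond P 0 → ℝ) :
    ∑ β, ∑ β', sigB b β * sigB b' β' * Kv β β' = Kv b b' := by
  unfold sigB
  simp only [ite_mul, one_mul, zero_mul, Finset.sum_ite_irrel, Finset.sum_const_zero, Finset.sum_ite_eq',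
    Finset.mem_univ, if_true]

/-- Two outputs of averaging vertices: the entry of the (1.18) pairing kernel at the two block points and channels.
[cite: Balaban1983Higgs3, (1.18) p.415] -/
theorem sum2_sigO_sigO (y y' : HiggsLattice.Site P k) (c c' : Fin N)
    (Ko : HiggsLattice.Site P k × Fin N → HiggsLattice.Site P k × Fin N → ℝ) :
    ∑ r, ∑ r', sigO y c r * sigO y' c' r' * Ko r r' = Ko (y, c) (y', c') := by
  unfold sigO
  simp only [ite_mul, one_mul, zero_mul, Finset.sum_ite_irrel, Finset.sum_const_zero, Finset.sum_ite_eq',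
    Finset.mem_univ, if_true]


/-! ### External legs: the signed contraction of PRODUCT external fields is a product of leg evaluations -/

/-- An undifferentiated external φ′-leg evaluates the external field at its label: `Σ_p [p = (x,c)] φ(p.1)_{p.2} = φ(x)_c`.
[cite: Balaban1983Higgs3, p.419] -/
theorem sum_sigS_field (x : HiggsLattice.Site P 0) (c : Fin N) (φ : HiggsLattice.ScalarField P 0 N) :
    ∑ p, sigS x c p * φ p.1 p.2 = φ x c := by
  unfold sigS
  simp only [ite_mul, one_mul, zero_mul, Finset.sum_ite_eq', Finset.mem_univ, if_true]

/-- A DIFFERENTIATED external φ′-leg evaluates the COVARIANT DERIVATIVE of the external field at its bond: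
`Σ_p ((D_B̃ δ_p)(b))_c φ(p.1)_{p.2} = ((D^η_B̃ φ)(b))_c` (p. 426: *"The external fields are estimated further by the Hölder norms"* —
here of `D φ`). [cite: Balaban1983Higgs3, p.426] [cite: Balaban1982Higgs1, (1.7) p.605] -/
theorem sum_sigD_field (C : ChargeData N) (B : HiggsLattice.VecField P 0) (b : HiggsLattice.PBond P 0) (c : Fin N)
    (φ : HiggsLattice.ScalarField P 0 N) : ∑ p, sigD C B b c p * φ p.1 p.2 = covDeriv C B φ b c := by
  unfold sigD
  conv_rhs => rw [← sum_coord_smul_basisE φ, B3DifferentiatedLineKernels.covDeriv_sum_smul_basisE]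
  rw [WithLp.ofLp_sum, Finset.sum_apply]
  exact Finset.sum_congr rfl fun p _ => by rw [WithLp.ofLp_smul, Pi.smul_apply, smul_eq_mul, mul_comm]

/-- **Signed contraction of PRODUCT external scalar fields** (FILE 2's `extS`): the sum over the external legs' indices of the
signed attachments times `Π_ℓ φ_ℓ` is the PRODUCT over the external legs of the single-leg evaluations `Σ_p σ_e(p) φ_e(p)` — by
`sum_sigS_field` ∕ `sum_sigD_field` the field, resp. its covariant derivative, at the leg's label. [cite: Balaban1983Higgs3, p.419] -/
theorem extS_signed_contraction {nbar : ℕ} (G : Graph nbar) (σ : ExtSLeg G → HiggsLattice.Site P 0 × Fin N → ℝ)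
    (φ : ExtSLeg G → HiggsLattice.ScalarField P 0 N) :
    ∑ γ : ExtSLeg G → HiggsLattice.Site P 0 × Fin N, (∏ e, σ e (γ e)) * extS G φ γ = ∏ e, ∑ p, σ e p * φ e p.1 p.2 := by
  unfold extS
  rw [Fintype.prod_sum (fun e p => σ e p * φ e p.1 p.2)]
  exact Finset.sum_congr rfl fun γ _ => by rw [← Finset.prod_mul_distrib]

/-! ### Averaged A′-legs ((1.14), (1.15)): for a LINEAR contour functional the effective vector-line kernel is the
contour-averaged covariance of (2.12) -/

/-- For a linear contour functional `ctr a x = Σ_b w(x,b)·a(b)` (the tree's `η·[b ∈ Γ^{(k)}_{y,x}]`-weights) the signed attachment of an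
averaged A′-leg is the contour weight: `Σ_β ctr(δ_β)(x) f(β) = Σ_b w(x,b) f(b)`. [cite: Balaban1983Higgs3, (1.14) p.413] -/
theorem sum_ctr_basisV_mul [DecidableEq (HiggsLattice.PBond P 0)] (ctr : HiggsLattice.VecField P 0 → HiggsLattice.Site P 0 → ℝ)
    (w : HiggsLattice.Site P 0 → HiggsLattice.PBond P 0 → ℝ) (hctr : ∀ a x, ctr a x = ∑ b, w x b * a b) (x : HiggsLattice.Site P 0)
    (f : HiggsLattice.PBond P 0 → ℝ) : ∑ β, ctr (basisV β) x * f β = ∑ b, w x b * f b := by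
  refine Finset.sum_congr rfl fun β _ => ?_
  rw [hctr]
  unfold basisV
  simp only [mul_ite, mul_one, mul_zero, Finset.sum_ite_eq', Finset.mem_univ, if_true]

/-- **Two averaged A′-legs** (both endpoints in vertices (1.14)/(1.15)), linear contour functional: the effective vector-line kernel is
the DOUBLY CONTOUR-AVERAGED covariance `Σ_{b,b′} w(x,b) w(x′,b′) Kv(b,b′)` — print's `⟨A′(Γ_{·,x}) A′(Γ_{·,x′})⟩`, the object of (2.12)
(*"For each such expression we have an additional factor L^jη"*). [cite: Balaban1983Higgs3, (2.12) p.426] -/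
theorem sum2_ctr_ctr [DecidableEq (HiggsLattice.PBond P 0)] (ctr : HiggsLattice.VecField P 0 → HiggsLattice.Site P 0 → ℝ)
    (w : HiggsLattice.Site P 0 → HiggsLattice.PBond P 0 → ℝ) (hctr : ∀ a x, ctr a x = ∑ b, w x b * a b) (x x' : HiggsLattice.Site P 0)
    (Kv : HiggsLattice.PBond P 0 → HiggsLattice.PBond P 0 → ℝ) :
    ∑ β, ∑ β', ctr (basisV β) x * ctr (basisV β') x' * Kv β β' = ∑ b, ∑ b', w x b * w x' b' * Kv b b' := by
  have h1 : ∀ β, ∑ β', ctr (basisV β) x * ctr (basisV β') x' * Kv β β' = ctr (basisV β) x * ∑ b', w x' b' * Kv β b' := by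
    intro β
    rw [← sum_ctr_basisV_mul ctr w hctr x' (Kv β), Finset.mul_sum]
    exact Finset.sum_congr rfl fun β' _ => by ring
  simp only [h1]
  rw [sum_ctr_basisV_mul ctr w hctr x]
  refine Finset.sum_congr rfl fun b _ => ?_
  rw [Finset.mul_sum]
  exact Finset.sum_congr rfl fun b' _ => by ring

/-- **An averaged A′-leg against an A′-leg of a bond vertex at `b′`**: the effective kernel is the SINGLY contour-averaged covariance
`Σ_b w(x,b) Kv(b, b′)` — print's `G^η_{(j)}(Γ^{(j+1)}_{x_{j+1},x}, b)` of (2.12). [cite: Balaban1983Higgs3, (2.12) p.426] -/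
theorem sum2_ctr_sigB [DecidableEq (HiggsLattice.PBond P 0)] (ctr : HiggsLattice.VecField P 0 → HiggsLattice.Site P 0 → ℝ)
    (w : HiggsLattice.Site P 0 → HiggsLattice.PBond P 0 → ℝ) (hctr : ∀ a x, ctr a x = ∑ b, w x b * a b) (x : HiggsLattice.Site P 0)
    (b' : HiggsLattice.PBond P 0) (Kv : HiggsLattice.PBond P 0 → HiggsLattice.PBond P 0 → ℝ) :
    ∑ β, ∑ β', ctr (basisV β) x * sigB b' β' * Kv β β' = ∑ b, w x b * Kv b b' := by
  have h1 : ∀ β, ∑ β', ctr (basisV β) x * sigB b' β' * Kv β β' = ctr (basisV β) x * Kv β b' := by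
    intro β
    rw [← sum_sigB_mul b' (Kv β), Finset.mul_sum]
    exact Finset.sum_congr rfl fun β' _ => by ring
  simp only [h1]
  exact sum_ctr_basisV_mul ctr w hctr x _

/-- … and in the other order: `Σ_{β,β′} [β = b] ctr(δ_{β′})(x′) Kv(β,β′) = Σ_{b′} w(x′,b′) Kv(b, b′)`. [cite: Balaban1983Higgs3, (2.12) p.426] -/
theorem sum2_sigB_ctr [DecidableEq (HiggsLattice.PBond P 0)] (ctr : HiggsLattice.VecField P 0 → HiggsLattice.Site P 0 → ℝ)
    (w : HiggsLattice.Site P 0 → HiggsLattice.PBond P 0 → ℝ) (hctr : ∀ a x, ctr a x = ∑ b, w x b * a b) (b : HiggsLattice.PBond P 0)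
    (x' : HiggsLattice.Site P 0) (Kv : HiggsLattice.PBond P 0 → HiggsLattice.PBond P 0 → ℝ) :
    ∑ β, ∑ β', sigB b β * ctr (basisV β') x' * Kv β β' = ∑ b', w x' b' * Kv b b' := by
  have h1 : ∀ β, ∑ β', sigB b β * ctr (basisV β') x' * Kv β β' = sigB b β * ∑ b', w x' b' * Kv β b' := by
    intro β
    rw [← sum_ctr_basisV_mul ctr w hctr x' (Kv β), Finset.mul_sum]
    exact Finset.sum_congr rfl fun β' _ => by ring
  simp only [h1]
  exact sum_sigB_mul b _

/-! ## §3 The exact label form of the nine printed vertices and of E(G, {□(v)}, Φ_ext, A_ext) -/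

/-- The LABEL of a vertex: its position (a site for (1.6), (1.7), (1.13)–(1.15); a bond for (1.8)–(1.11)) and two internal
channels. [cite: Balaban1983Higgs3, (1.6)–(1.15) pp.413–414] -/
abbrev Lab (P : HiggsLattice.Params) (N : ℕ) : Type := (HiggsLattice.Site P 0 ⊕ HiggsLattice.PBond P 0) × Fin N × Fin N

/-- The POSITION of a label: the site, resp. the initial point `b₋` of the bond. [cite: Balaban1983Higgs3, p.426] -/
def Lab.pos (ξ : Lab P N) : HiggsLattice.Site P 0 := Sum.elim id HiggsLattice.PBond.src ξ.1

/-- **The signed attachment of the `j`-th φ′-leg of a vertex of kind `κ` at the label `ξ`**: Kronecker deltas at the position with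
the leg's channel; for the DIFFERENTIATED leg `0` of (1.8)/(1.9) the component `((D_B̃ δ_p)(b))_c` (`sigD`).
[cite: Balaban1983Higgs3, (1.6)–(1.15) pp.413–414] -/
def sigSK (M : Model P N k) : (κ : VertexKind) → Fin κ.scalarLegs → Lab P N → HiggsLattice.Site P 0 × Fin N → ℝ
  | .v16, j, (Sum.inl x, c, c'), p => if j.val < 2 then sigS x c p else sigS x c' p
  | .v16, _, (Sum.inr _, _, _), _ => 0
  | .v17, j, (Sum.inl x, c, c'), p => if j.val = 0 then sigS x c p else sigS x c' p
  | .v17, _, (Sum.inr _, _, _), _ => 0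
  | .v18 _ _, j, (Sum.inr b, c, c'), p => if j.val = 0 then sigD M.C M.B b c p else sigS b.src c' p
  | .v18 _ _, _, (Sum.inl _, _, _), _ => 0
  | .v19 _ _, j, (Sum.inr b, c, c'), p => if j.val = 0 then sigD M.C M.B b c p else sigS b.src c' p
  | .v19 _ _, _, (Sum.inl _, _, _), _ => 0
  | .v110 _ _, j, (Sum.inr b, c, c'), p => if j.val = 0 then sigS b.src c p else sigS b.src c' p
  | .v110 _ _, _, (Sum.inl _, _, _), _ => 0
  | .v111 _ _, j, (Sum.inr b, c, c'), p => if j.val = 0 then sigS b.src c p else sigS b.src c' p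
  | .v111 _ _, _, (Sum.inl _, _, _), _ => 0
  | .v113, _, (Sum.inl x, c, _), p => sigS x c p
  | .v113, _, (Sum.inr _, _, _), _ => 0
  | .v114 _ _, _, (Sum.inl x, c, _), p => sigS x c p
  | .v114 _ _, _, (Sum.inr _, _, _), _ => 0
  | .v115 _ _, _, (Sum.inl x, c, _), p => sigS x c p
  | .v115 _ _, _, (Sum.inr _, _, _), _ => 0

variable [DecidableEq (HiggsLattice.PBond P 0)]

/-- **The signed attachment of the `j`-th A′-leg**: `[β = b]` for the bond vertices (1.8)–(1.11), the contour functional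
`ctr(δ_β)(x)` of FILE 2's `Model` for the averaging vertices (1.14), (1.15). [cite: Balaban1983Higgs3, (1.8) p.413]
[cite: Balaban1983Higgs3, (1.14) p.413] -/
def sigVK (M : Model P N k) : (κ : VertexKind) → Fin κ.vectorLegs → Lab P N → HiggsLattice.PBond P 0 → ℝ
  | .v18 _ _, _, (Sum.inr b, _, _), β => sigB b β
  | .v19 _ _, _, (Sum.inr b, _, _), β => sigB b β
  | .v110 _ _, _, (Sum.inr b, _, _), β => sigB b β
  | .v111 _ _, _, (Sum.inr b, _, _), β => sigB b β
  | .v114 _ _, _, (Sum.inl x, _, _), β => M.ctr (basisV β) x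
  | .v115 _ _, _, (Sum.inl x, _, _), β => M.ctr (basisV β) x
  | _, _, _, _ => 0

/-- **The signed attachment of the output of an averaging vertex**: `[r = (x^{(k)}, c′)]` (the output read at the block point of the
φ′-leg's site). [cite: Balaban1983Higgs3, (1.13) p.413] -/
def sigOK (k : ℕ) : (κ : VertexKind) → Fin (outSlots κ) → Lab P N → HiggsLattice.Site P k × Fin N → ℝ
  | .v113, _, (Sum.inl x, _, c'), r => sigO (blockIter k x) c' r
  | .v114 _ _, _, (Sum.inl x, _, c'), r => sigO (blockIter k x) c' r
  | .v115 _ _, _, (Sum.inl x, _, c'), r => sigO (blockIter k x) c' r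
  | _, _, _, _ => 0

/-- The per-site operator of (1.13) on the φ′-leg: `−w·U(B̃(Γ_{y,x}))`. [cite: Balaban1983Higgs3, (1.13) p.413] -/
def op113 (M : Model P N k) (x : HiggsLattice.Site P 0) : HiggsCovariance.E N →L[ℝ] HiggsCovariance.E N :=
  -(M.w • M.C.U 1 (M.β x))

/-- The per-site operator of (1.14)_{n,n′} on the φ′-leg (the A′-leg factors split off):
`−e^{n+n′}/(n!n′!)·w·(Ã(Γ))^{n′}·q^{n+n′}U(B̃(Γ))`. [cite: Balaban1983Higgs3, (1.14) p.413] -/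
def op114 (M : Model P N k) (n n' : ℕ) (x : HiggsLattice.Site P 0) : HiggsCovariance.E N →L[ℝ] HiggsCovariance.E N :=
  (-(M.C.e ^ (n + n') * (1 / ((n.factorial : ℝ) * n'.factorial))) * (M.w * M.τ x ^ n')) •
    ((M.C.q ^ (n + n')).comp (M.C.U 1 (M.β x)))

/-- The per-site operator of (1.15)_{n̄,n} on the φ′-leg: `−e^{n+n̄+1}/(n!(n̄+1)!)·w·(Ã(Γ))^{n̄+1}·q^{n+n̄+1}R_{n̄+1}(…)U(B̃(Γ))`.
[cite: Balaban1983Higgs3, (1.15) p.414] -/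
def op115 (M : Model P N k) (nbar n : ℕ) (x : HiggsLattice.Site P 0) : HiggsCovariance.E N →L[ℝ] HiggsCovariance.E N :=
  (-(M.C.e ^ (n + nbar + 1) * (1 / ((n.factorial : ℝ) * (nbar + 1).factorial))) * (M.w * M.τ x ^ (nbar + 1))) •
    ((M.C.q ^ (n + nbar + 1) * taylorRemOp nbar ((M.C.e * M.τ x) • M.C.q)).comp (M.C.U 1 (M.β x)))

/-- **The vertex COEFFICIENT at a label** (`ū_v(ξ)`): couplings, `η`-powers (`η^{n+n′−1}` for (1.8) — NO `η⁻¹`, the difference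
quotient sits in `sigD`), cut-offs, `Ã`-powers, the localization weight, and the channel tensor of the vertex (`δ_{cc′}`,
`(q^m e_{c′})_c`, `(q^m R_{n̄+1} e_{c′})_c`, `(U(B̃(Γ)) e_c)_{c′}` …). [cite: Balaban1983Higgs3, (1.6)–(1.15) pp.413–414] -/
def ubOfKind (M : Model P N k) (dm2 : HiggsLattice.Site P 0 → ℝ) (l : Loc P k) : (κ : VertexKind) → Lab P N → ℝ
  | .v16, (Sum.inl x, _, _) =>
      -(M.lamRun * ((if x ∈ M.Ω₁ then 1 else 0) * (l.wS x * P.mesh 0 ^ P.d)))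
  | .v17, (Sum.inl x, c, c') =>
      if c' = c then -(1 / 2 : ℝ) * ((if x ∈ M.Ω₁ then 1 else 0) * (l.wS x * (P.mesh 0 ^ P.d * dm2 x * M.ell ^ 2))) else 0
  | .v18 n n', (Sum.inr b, c, c') =>
      M.C.e ^ (n + n') * ((-1 : ℝ) ^ (n + n') * P.mesh 0 ^ ((n + n' : ℤ) - 1) / ((n.factorial : ℝ) * n'.factorial)) *
        ((if b ∈ M.S then 1 else 0) * (l.wB b * (P.mesh 0 ^ P.d *
          (M.C.q ^ (n + n')) (EuclideanSpace.single c' (1 : ℝ)) c * M.g b.src ^ n * M.At b ^ n')))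
  | .v19 n nb, (Sum.inr b, c, c') =>
      M.C.e ^ (n + nb + 1) * ((-1 : ℝ) ^ (n + nb + 1) * P.mesh 0 ^ (n + nb) / ((n.factorial : ℝ) * (nb + 1).factorial)) *
        ((if b ∈ M.S then 1 else 0) * (l.wB b * (P.mesh 0 ^ P.d *
          (M.C.q ^ (n + nb + 1) * remTensor M.C nb M.At b) (EuclideanSpace.single c' (1 : ℝ)) c *
            M.g b.src ^ n * M.At b ^ (nb + 1))))
  | .v110 n n', (Sum.inr b, c, c') =>
      M.C.e ^ (n + n') * (P.mesh 0 ^ ((n + n' : ℤ) - 2) / ((n.factorial : ℝ) * n'.factorial)) *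
        ((if b ∈ M.S then 1 else 0) * (l.wB b * (P.mesh 0 ^ P.d *
          (M.C.q ^ (n + n')) (EuclideanSpace.single c' (1 : ℝ)) c * M.g b.src ^ n * M.At b ^ n')))
  | .v111 n nb, (Sum.inr b, c, c') =>
      M.C.e ^ (n + nb + 1) * ((-1 : ℝ) ^ (n + nb + 1) * P.mesh 0 ^ ((n + nb : ℤ) - 1) / ((n.factorial : ℝ) * (nb + 1).factorial)) *
        ((if b ∈ M.S then 1 else 0) * (l.wB b * (P.mesh 0 ^ P.d *
          (M.C.q ^ (n + nb + 1) * remTensor M.C nb M.At b) (EuclideanSpace.single c' (1 : ℝ)) c *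
            M.g b.src ^ n * M.At b ^ (nb + 1))))
  | .v113, (Sum.inl x, c, c') =>
      (if blockIter k x ∈ M.Y then l.wY (blockIter k x) else 0) * op113 M x (EuclideanSpace.single c (1 : ℝ)) c'
  | .v114 n n', (Sum.inl x, c, c') =>
      (if blockIter k x ∈ M.Y then l.wY (blockIter k x) else 0) * op114 M n n' x (EuclideanSpace.single c (1 : ℝ)) c'
  | .v115 n nb, (Sum.inl x, c, c') =>
      (if blockIter k x ∈ M.Y then l.wY (blockIter k x) else 0) * op115 M nb n x (EuclideanSpace.single c (1 : ℝ)) c'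
  | _, _ => 0

omit [DecidableEq (HiggsLattice.PBond P 0)] in
/-- kernel: a sum over a finite set as a sum over everything against the indicator (right factor). [folklore] -/
private theorem sum_mem_eq_sum_ite' {Y : Type*} [Fintype Y] [DecidableEq Y] (s : Finset Y) (f : Y → ℝ) :
    ∑ x ∈ s, f x = ∑ x, (if x ∈ s then (1 : ℝ) else 0) * f x := by
  simp only [ite_mul, one_mul, zero_mul]
  rw [Finset.sum_ite_mem, Finset.univ_inter]

omit [DecidableEq (HiggsLattice.PBond P 0)] in
/-- kernel: a sum over the labels is the site part plus the bond part, each a triple sum. [folklore] -/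
private theorem sum_Lab (f : Lab P N → ℝ) :
    ∑ ξ : Lab P N, f ξ = (∑ x, ∑ c : Fin N, ∑ c' : Fin N, f (Sum.inl x, c, c')) +
      ∑ b, ∑ c : Fin N, ∑ c' : Fin N, f (Sum.inr b, c, c') := by
  rw [Fintype.sum_prod_type, Fintype.sum_sum_type]
  congr 1
  · exact Finset.sum_congr rfl fun x _ => Fintype.sum_prod_type _
  · exact Finset.sum_congr rfl fun b _ => Fintype.sum_prod_type _

/-- **(1.8)_{n,n′} in exact label form** (the differentiated leg through `sigD`, the leg at `b₋` and the A′-legs through deltas,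
the channel tensor `(q^{n+n′} e_{c′})_c` and `η^{n+n′−1}` in the coefficient). [cite: Balaban1983Higgs3, (1.8) p.413] -/
theorem labelForm_v18 (M : Model P N k) (dm2 : HiggsLattice.Site P 0 → ℝ) (l : Loc P k) (n n' : ℕ)
    (aS : Fin 2 → HiggsLattice.Site P 0 × Fin N) (aV : Fin n → HiggsLattice.PBond P 0)
    (aO : Fin 0 → HiggsLattice.Site P k × Fin N) :
    rule18 M.C M.g M.B M.At n n' M.S l.wB (fun j => basisE (aS j)) (fun j => basisV (aV j)) =
      ∑ ξ : Lab P N, ubOfKind M dm2 l (.v18 n n') ξ *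
        ((∏ j : Fin 2, sigSK M (.v18 n n') j ξ (aS j)) * (∏ j : Fin n, sigVK M (.v18 n n') j ξ (aV j)) *
          ∏ j : Fin 0, sigOK k (.v18 n n') j ξ (aO j)) := by
  unfold rule18
  rw [sum_mem_eq_sum_ite', Finset.mul_sum, sum_Lab]
  simp only [ubOfKind, zero_mul, Finset.sum_const_zero, zero_add]
  refine Finset.sum_congr rfl fun b _ => ?_
  unfold pleg18
  rw [inner_covDeriv_basisE_op_basisE, vlegs_basisV]
  simp only [Finset.mul_sum, Finset.sum_mul]
  refine Finset.sum_congr rfl fun c _ => Finset.sum_congr rfl fun c' _ => ?_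
  simp only [sigSK, sigVK, Fin.prod_univ_two, Finset.univ_eq_empty, Finset.prod_empty, Fin.val_zero, Fin.val_one,
    if_true, one_ne_zero, if_false]
  ring

omit [DecidableEq (HiggsLattice.PBond P 0)] in
/-- The scalar product of two basis fields at a site, in signed one-channel form: `δ_p(x)·δ_q(x) = Σ_c [p=(x,c)][q=(x,c)]`.
[cite: Balaban1983Higgs3, p.414] -/
theorem inner_basisE_basisE_sig (p q : HiggsLattice.Site P 0 × Fin N) (x : HiggsLattice.Site P 0) :
    inner ℝ (basisE p x) (basisE q x) = ∑ c, sigS x c p * sigS x c q := by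
  rw [inner_basisE, sum_sigS_mul]
  unfold sigS
  obtain ⟨x₁, a⟩ := p
  obtain ⟨x₂, a'⟩ := q
  by_cases h1 : x = x₁
  · subst h1
    by_cases h2 : x = x₂
    · subst h2
      by_cases h3 : a = a'
      · subst h3; simp
      · simp [h3, Prod.ext_iff, Ne.symm h3]
    · simp [h2, Prod.ext_iff, Ne.symm h2]
  · simp [h1, Ne.symm h1]

/-- **(1.6) in exact label form** (two channel pairs `δ_{c₀c₁}δ_{c₂c₃}`). [cite: Balaban1983Higgs3, (1.6) p.413] -/
theorem labelForm_v16 (M : Model P N k) (dm2 : HiggsLattice.Site P 0 → ℝ) (l : Loc P k)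
    (aS : Fin 4 → HiggsLattice.Site P 0 × Fin N) (aV : Fin 0 → HiggsLattice.PBond P 0)
    (aO : Fin 0 → HiggsLattice.Site P k × Fin N) :
    rule16 M.lamRun M.Ω₁ l.wS (fun j => basisE (aS j)) =
      ∑ ξ : Lab P N, ubOfKind M dm2 l .v16 ξ *
        ((∏ j : Fin 4, sigSK M .v16 j ξ (aS j)) * (∏ j : Fin 0, sigVK M .v16 j ξ (aV j)) *
          ∏ j : Fin 0, sigOK k .v16 j ξ (aO j)) := by
  unfold rule16
  rw [sum_mem_eq_sum_ite', Finset.mul_sum, ← Finset.sum_neg_distrib, sum_Lab]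
  simp only [ubOfKind, zero_mul, Finset.sum_const_zero, add_zero]
  refine Finset.sum_congr rfl fun x _ => ?_
  rw [inner_basisE_basisE_sig, inner_basisE_basisE_sig, Finset.sum_mul_sum]
  simp only [Finset.mul_sum, ← Finset.sum_neg_distrib]
  refine Finset.sum_congr rfl fun c _ => Finset.sum_congr rfl fun c' _ => ?_
  simp only [sigSK, Fin.prod_univ_four, Finset.univ_eq_empty, Finset.prod_empty]
  rw [if_pos (show ((0 : Fin 4) : ℕ) < 2 by decide), if_pos (show ((1 : Fin 4) : ℕ) < 2 by decide),
    if_neg (show ¬ ((2 : Fin 4) : ℕ) < 2 by decide), if_neg (show ¬ ((3 : Fin 4) : ℕ) < 2 by decide)]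
  ring

/-- **(1.7) in exact label form** (one channel pair `δ_{cc′}` in the coefficient). [cite: Balaban1983Higgs3, (1.7) p.413] -/
theorem labelForm_v17 (M : Model P N k) (dm2 : HiggsLattice.Site P 0 → ℝ) (l : Loc P k)
    (aS : Fin 2 → HiggsLattice.Site P 0 × Fin N) (aV : Fin 0 → HiggsLattice.PBond P 0)
    (aO : Fin 0 → HiggsLattice.Site P k × Fin N) :
    rule17 dm2 M.ell M.Ω₁ l.wS (fun j => basisE (aS j)) =
      ∑ ξ : Lab P N, ubOfKind M dm2 l .v17 ξ *
        ((∏ j : Fin 2, sigSK M .v17 j ξ (aS j)) * (∏ j : Fin 0, sigVK M .v17 j ξ (aV j)) *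
          ∏ j : Fin 0, sigOK k .v17 j ξ (aO j)) := by
  unfold rule17
  rw [sum_mem_eq_sum_ite', Finset.mul_sum, sum_Lab]
  simp only [ubOfKind, zero_mul, Finset.sum_const_zero, add_zero]
  refine Finset.sum_congr rfl fun x _ => ?_
  rw [inner_basisE_basisE_sig]
  simp only [Finset.mul_sum]
  refine Finset.sum_congr rfl fun c _ => ?_
  simp only [sigSK, Fin.prod_univ_two, Finset.univ_eq_empty, Finset.prod_empty, Fin.val_zero, Fin.val_one, if_true,
    one_ne_zero, if_false, ite_zero_mul]
  rw [Finset.sum_ite_eq' Finset.univ c]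
  simp only [Finset.mem_univ, if_true]
  split_ifs <;> ring

/-- **(1.9) in exact label form** (as (1.8), channel tensor `(q^{n+n̄+1}R_{n̄+1} e_{c′})_c`). [cite: Balaban1983Higgs3, (1.9) p.413] -/
theorem labelForm_v19 (M : Model P N k) (dm2 : HiggsLattice.Site P 0 → ℝ) (l : Loc P k) (n nb : ℕ)
    (aS : Fin 2 → HiggsLattice.Site P 0 × Fin N) (aV : Fin n → HiggsLattice.PBond P 0)
    (aO : Fin 0 → HiggsLattice.Site P k × Fin N) :
    rule19 M.C M.g M.B M.At nb n M.S l.wB (fun j => basisE (aS j)) (fun j => basisV (aV j)) =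
      ∑ ξ : Lab P N, ubOfKind M dm2 l (.v19 n nb) ξ *
        ((∏ j : Fin 2, sigSK M (.v19 n nb) j ξ (aS j)) * (∏ j : Fin n, sigVK M (.v19 n nb) j ξ (aV j)) *
          ∏ j : Fin 0, sigOK k (.v19 n nb) j ξ (aO j)) := by
  unfold rule19
  rw [sum_mem_eq_sum_ite', Finset.mul_sum, sum_Lab]
  simp only [ubOfKind, zero_mul, Finset.sum_const_zero, zero_add]
  refine Finset.sum_congr rfl fun b _ => ?_
  unfold pleg18
  rw [inner_covDeriv_basisE_op_basisE, vlegs_basisV]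
  simp only [Finset.mul_sum, Finset.sum_mul]
  refine Finset.sum_congr rfl fun c _ => Finset.sum_congr rfl fun c' _ => ?_
  simp only [sigSK, sigVK, Fin.prod_univ_two, Finset.univ_eq_empty, Finset.prod_empty, Fin.val_zero, Fin.val_one,
    if_true, one_ne_zero, if_false]
  ring

/-- **(1.10)_{n,n′} in exact label form** (both φ′-legs at `b₋`, channel tensor `(q^{n+n′} e_{c′})_c`, `η^{n+n′−2}`).
[cite: Balaban1983Higgs3, (1.10) p.413] -/
theorem labelForm_v110 (M : Model P N k) (dm2 : HiggsLattice.Site P 0 → ℝ) (l : Loc P k) (n n' : ℕ)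
    (aS : Fin 2 → HiggsLattice.Site P 0 × Fin N) (aV : Fin n → HiggsLattice.PBond P 0)
    (aO : Fin 0 → HiggsLattice.Site P k × Fin N) :
    rule110 M.C M.g M.At n n' M.S l.wB (fun j => basisE (aS j)) (fun j => basisV (aV j)) =
      ∑ ξ : Lab P N, ubOfKind M dm2 l (.v110 n n') ξ *
        ((∏ j : Fin 2, sigSK M (.v110 n n') j ξ (aS j)) * (∏ j : Fin n, sigVK M (.v110 n n') j ξ (aV j)) *
          ∏ j : Fin 0, sigOK k (.v110 n n') j ξ (aO j)) := by
  unfold rule110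
  rw [sum_mem_eq_sum_ite', Finset.mul_sum, sum_Lab]
  simp only [ubOfKind, zero_mul, Finset.sum_const_zero, zero_add]
  refine Finset.sum_congr rfl fun b _ => ?_
  unfold pleg110
  rw [inner_basisE_op_basisE, vlegs_basisV]
  simp only [Finset.mul_sum, Finset.sum_mul]
  refine Finset.sum_congr rfl fun c _ => Finset.sum_congr rfl fun c' _ => ?_
  simp only [sigSK, sigVK, Fin.prod_univ_two, Finset.univ_eq_empty, Finset.prod_empty, Fin.val_zero, Fin.val_one,
    if_true, one_ne_zero, if_false]
  ring

/-- **(1.11) in exact label form**. [cite: Balaban1983Higgs3, (1.11) p.413] -/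
theorem labelForm_v111 (M : Model P N k) (dm2 : HiggsLattice.Site P 0 → ℝ) (l : Loc P k) (n nb : ℕ)
    (aS : Fin 2 → HiggsLattice.Site P 0 × Fin N) (aV : Fin n → HiggsLattice.PBond P 0)
    (aO : Fin 0 → HiggsLattice.Site P k × Fin N) :
    rule111 M.C M.g M.At nb n M.S l.wB (fun j => basisE (aS j)) (fun j => basisV (aV j)) =
      ∑ ξ : Lab P N, ubOfKind M dm2 l (.v111 n nb) ξ *
        ((∏ j : Fin 2, sigSK M (.v111 n nb) j ξ (aS j)) * (∏ j : Fin n, sigVK M (.v111 n nb) j ξ (aV j)) *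
          ∏ j : Fin 0, sigOK k (.v111 n nb) j ξ (aO j)) := by
  unfold rule111
  rw [sum_mem_eq_sum_ite', Finset.mul_sum, sum_Lab]
  simp only [ubOfKind, zero_mul, Finset.sum_const_zero, zero_add]
  refine Finset.sum_congr rfl fun b _ => ?_
  unfold pleg110
  rw [inner_basisE_op_basisE, vlegs_basisV]
  simp only [Finset.mul_sum, Finset.sum_mul]
  refine Finset.sum_congr rfl fun c _ => Finset.sum_congr rfl fun c' _ => ?_
  simp only [sigSK, sigVK, Fin.prod_univ_two, Finset.univ_eq_empty, Finset.prod_empty, Fin.val_zero, Fin.val_one,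
    if_true, one_ne_zero, if_false]
  ring

omit [DecidableEq (HiggsLattice.PBond P 0)] in
/-- kernel: a scalar multiple of an operator, applied. [folklore] -/
private theorem clm_smul_apply' (c : ℝ) (T : HiggsCovariance.E N →L[ℝ] HiggsCovariance.E N) (v : HiggsCovariance.E N) :
    (c • T) v = c • T v := rfl

omit [DecidableEq (HiggsLattice.PBond P 0)] in
/-- (1.13) on its φ′-leg is the block sum of the per-site operators `op113`. [cite: Balaban1983Higgs3, (1.13) p.413] -/
theorem vertex113_eq_sum_op (M : Model P N k) (φ : HiggsLattice.ScalarField P 0 N) (y : HiggsLattice.Site P k) :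
    vertex113 M.C M.w M.β φ k y = ∑ x ∈ blockK k y, op113 M x (φ x) := by
  unfold vertex113 op113
  rw [Finset.smul_sum, ← Finset.sum_neg_distrib]
  rfl

/-- (1.14) on its φ′-leg, the A′-legs on basis bond fields: the block sum of `(Π_j ctr(δ_{β_j})(x))·op114`.
[cite: Balaban1983Higgs3, (1.14) p.413] -/
theorem avg114_eq_sum_op (M : Model P N k) (n n' : ℕ) (φ : HiggsLattice.ScalarField P 0 N) (aV : Fin n → HiggsLattice.PBond P 0)
    (y : HiggsLattice.Site P k) :
    avg114 M.C M.w M.β M.τ M.ctr k n n' y φ (fun j => basisV (aV j)) =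
      ∑ x ∈ blockK k y, ((∏ j : Fin n, M.ctr (basisV (aV j)) x) • op114 M n n' x) (φ x) := by
  unfold avg114 op114
  simp only [Finset.smul_sum, smul_smul]
  rw [← Finset.sum_neg_distrib]
  refine Finset.sum_congr rfl fun x _ => ?_
  rw [← neg_smul]
  change _ = ((∏ j : Fin n, M.ctr (basisV (aV j)) x) *
      (-(M.C.e ^ (n + n') * (1 / ((n.factorial : ℝ) * n'.factorial))) * (M.w * M.τ x ^ n'))) •
    (M.C.q ^ (n + n')) ((M.C.U 1 (M.β x)) (φ x))
  congr 1
  ring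

/-- (1.15) likewise with `op115`. [cite: Balaban1983Higgs3, (1.15) p.414] -/
theorem avg115_eq_sum_op (M : Model P N k) (nbar n : ℕ) (φ : HiggsLattice.ScalarField P 0 N) (aV : Fin n → HiggsLattice.PBond P 0)
    (y : HiggsLattice.Site P k) :
    avg115 M.C M.w M.β M.τ M.ctr k nbar n y φ (fun j => basisV (aV j)) =
      ∑ x ∈ blockK k y, ((∏ j : Fin n, M.ctr (basisV (aV j)) x) • op115 M nbar n x) (φ x) := by
  unfold avg115 op115
  simp only [Finset.smul_sum, smul_smul]
  rw [← Finset.sum_neg_distrib]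
  refine Finset.sum_congr rfl fun x _ => ?_
  rw [← neg_smul]
  change _ = ((∏ j : Fin n, M.ctr (basisV (aV j)) x) *
      (-(M.C.e ^ (n + nbar + 1) * (1 / ((n.factorial : ℝ) * (nbar + 1).factorial))) * (M.w * M.τ x ^ (nbar + 1)))) •
    (M.C.q ^ (n + nbar + 1) * taylorRemOp nbar ((M.C.e * M.τ x) • M.C.q)) ((M.C.U 1 (M.β x)) (φ x))
  congr 1
  ring

/-- **(1.13) in exact label form** (φ′-leg at the fine site, output at its block point, channel tensor `(−wU(B̃(Γ)) e_c)_{c′}`).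
[cite: Balaban1983Higgs3, (1.13) p.413] -/
theorem labelForm_v113 (M : Model P N k) (dm2 : HiggsLattice.Site P 0 → ℝ) (l : Loc P k)
    (aS : Fin 1 → HiggsLattice.Site P 0 × Fin N) (aV : Fin 0 → HiggsLattice.PBond P 0)
    (aO : Fin 1 → HiggsLattice.Site P k × Fin N) :
    rule113 M.C M.w M.β k M.Y l.wY (fun j => basisE (aS j)) (fun j => basisE (aO j)) =
      ∑ ξ : Lab P N, ubOfKind M dm2 l .v113 ξ *
        ((∏ j : Fin 1, sigSK M .v113 j ξ (aS j)) * (∏ j : Fin 0, sigVK M .v113 j ξ (aV j)) *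
          ∏ j : Fin 1, sigOK k .v113 j ξ (aO j)) := by
  unfold rule113
  simp only [vertex113_eq_sum_op]
  rw [avg_basis_labelForm, sum_Lab]
  simp only [ubOfKind, zero_mul, Finset.sum_const_zero, add_zero]
  refine Finset.sum_congr rfl fun x _ => Finset.sum_congr rfl fun c _ => Finset.sum_congr rfl fun c' _ => ?_
  simp only [sigSK, sigOK, Fin.prod_univ_one, Finset.univ_eq_empty, Finset.prod_empty]
  ring

/-- **(1.14)_{n,n′} in exact label form** (the A′-legs through the contour functional `ctr(δ_β)(x)`).
[cite: Balaban1983Higgs3, (1.14) p.413] -/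
theorem labelForm_v114 (M : Model P N k) (dm2 : HiggsLattice.Site P 0 → ℝ) (l : Loc P k) (n n' : ℕ)
    (aS : Fin 1 → HiggsLattice.Site P 0 × Fin N) (aV : Fin n → HiggsLattice.PBond P 0)
    (aO : Fin 1 → HiggsLattice.Site P k × Fin N) :
    rule114 M.C M.w M.β M.τ M.ctr k n n' M.Y l.wY (fun j => basisE (aS j)) (fun j => basisV (aV j))
        (fun j => basisE (aO j)) =
      ∑ ξ : Lab P N, ubOfKind M dm2 l (.v114 n n') ξ *
        ((∏ j : Fin 1, sigSK M (.v114 n n') j ξ (aS j)) * (∏ j : Fin n, sigVK M (.v114 n n') j ξ (aV j)) *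
          ∏ j : Fin 1, sigOK k (.v114 n n') j ξ (aO j)) := by
  unfold rule114
  simp only [avg114_eq_sum_op]
  rw [avg_basis_labelForm, sum_Lab]
  simp only [ubOfKind, zero_mul, Finset.sum_const_zero, add_zero]
  refine Finset.sum_congr rfl fun x _ => Finset.sum_congr rfl fun c _ => Finset.sum_congr rfl fun c' _ => ?_
  simp only [sigSK, sigVK, sigOK, Fin.prod_univ_one, clm_smul_apply', PiLp.smul_apply, smul_eq_mul]
  ring

/-- **(1.15) in exact label form**. [cite: Balaban1983Higgs3, (1.15) p.414] -/
theorem labelForm_v115 (M : Model P N k) (dm2 : HiggsLattice.Site P 0 → ℝ) (l : Loc P k) (n nb : ℕ)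
    (aS : Fin 1 → HiggsLattice.Site P 0 × Fin N) (aV : Fin n → HiggsLattice.PBond P 0)
    (aO : Fin 1 → HiggsLattice.Site P k × Fin N) :
    rule115 M.C M.w M.β M.τ M.ctr k nb n M.Y l.wY (fun j => basisE (aS j)) (fun j => basisV (aV j))
        (fun j => basisE (aO j)) =
      ∑ ξ : Lab P N, ubOfKind M dm2 l (.v115 n nb) ξ *
        ((∏ j : Fin 1, sigSK M (.v115 n nb) j ξ (aS j)) * (∏ j : Fin n, sigVK M (.v115 n nb) j ξ (aV j)) *
          ∏ j : Fin 1, sigOK k (.v115 n nb) j ξ (aO j)) := by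
  unfold rule115
  simp only [avg115_eq_sum_op]
  rw [avg_basis_labelForm, sum_Lab]
  simp only [ubOfKind, zero_mul, Finset.sum_const_zero, add_zero]
  refine Finset.sum_congr rfl fun x _ => Finset.sum_congr rfl fun c _ => Finset.sum_congr rfl fun c' _ => ?_
  simp only [sigSK, sigVK, sigOK, Fin.prod_univ_one, clm_smul_apply', PiLp.smul_apply, smul_eq_mul]
  ring

/-- **THE RULE OF EVERY KIND IN EXACT LABEL FORM** (dispatch): FILE 2's Feynman rule of a vertex of kind `κ` on the coordinate
bases equals `Σ_ξ ū_κ(ξ) · Π_{φ′-legs} σ^S_κj(ξ, ·) · Π_{A′-legs} σ^V_κj(ξ, ·) · Π_{outputs} σ^O_κj(ξ, ·)` — hypothesis (i) of §1's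
`amp_eq_labelForm` for every graph of p18's model. [cite: Balaban1983Higgs3, (1.6)–(1.15) pp.413–414] -/
theorem ruleOfKind_basis_labelForm (M : Model P N k) (dm2 : HiggsLattice.Site P 0 → ℝ) (l : Loc P k) (κ : VertexKind)
    (aS : Fin κ.scalarLegs → HiggsLattice.Site P 0 × Fin N) (aV : Fin κ.vectorLegs → HiggsLattice.PBond P 0)
    (aO : Fin (outSlots κ) → HiggsLattice.Site P k × Fin N) :
    ruleOfKind k M dm2 l κ (fun j => basisE (aS j)) (fun j => basisV (aV j)) (fun j => basisE (aO j)) =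
      ∑ ξ : Lab P N, ubOfKind M dm2 l κ ξ *
        ((∏ j, sigSK M κ j ξ (aS j)) * (∏ j, sigVK M κ j ξ (aV j)) * ∏ j, sigOK k κ j ξ (aO j)) := by
  cases κ with
  | v16 => exact labelForm_v16 M dm2 l aS aV aO
  | v17 => exact labelForm_v17 M dm2 l aS aV aO
  | v18 n n' => exact labelForm_v18 M dm2 l n n' aS aV aO
  | v19 n nb => exact labelForm_v19 M dm2 l n nb aS aV aO
  | v110 n n' => exact labelForm_v110 M dm2 l n n' aS aV aO
  | v111 n nb => exact labelForm_v111 M dm2 l n nb aS aV aO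
  | v113 => exact labelForm_v113 M dm2 l aS aV aO
  | v114 n n' => exact labelForm_v114 M dm2 l n n' aS aV aO
  | v115 n nb => exact labelForm_v115 M dm2 l n nb aS aV aO

end SignedAttach

/-! ## §4 The signed position form of E(G, {□(v)}, Φ_ext, A_ext): every graph of p18's model, (2.11) currency -/

section SignedConcrete

variable {P : HiggsLattice.Params} {N k nbar : ℕ} [DecidableEq (HiggsLattice.PBond P 0)]

open Literature.MathematicalPhysics.QuantumFieldTheory.Balaban1983to89.B3Prop1 (VertexKind)
open Literature.MathematicalPhysics.QuantumFieldTheory.Balaban1983to89.B3Ineq213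
open Literature.MathematicalPhysics.QuantumFieldTheory.Balaban1983to89.B3Ineq215 (Cube)
open Literature.MathematicalPhysics.QuantumFieldTheory.Balaban1983to89.HiggsAveraging (blockK blockIter)
open Literature.MathematicalPhysics.QuantumFieldTheory.Balaban1983to89.B3VertexTensorBounds (taylorRemOp)
open Literature.MathematicalPhysics.QuantumFieldTheory.Balaban1983to89.B3Eq18VertexExpansion (remTensor)

/-- **The VERTEX FUNCTION of the signed form** (`U_v(x) = Σ_{ξ ↦ x} |ū_v(ξ)|`): the ℓ¹-mass of the vertex coefficient over the labels
at the position `x` — couplings, `η^d`, the printed `η`-powers WITHOUT any `η⁻¹` for difference quotients, `|q| ≦ 1`-type channel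
tensors, cut-offs, `Ã`-powers and the localization weight. [cite: Balaban1983Higgs3, (2.13) p.426] [cite: Balaban1983Higgs3, (2.14) p.427] -/
def UOf (M : Model P N k) (dm2 : HiggsLattice.Site P 0 → ℝ) (l : Loc P k) (κ : VertexKind) (x : HiggsLattice.Site P 0) : ℝ :=
  ∑ ξ : Lab P N, if ξ.pos = x then |ubOfKind M dm2 l κ ξ| else 0

omit [DecidableEq (HiggsLattice.PBond P 0)] in
/-- `UOf ≥ 0`. [cite: Balaban1983Higgs3, (2.13) p.426] -/
theorem UOf_nonneg [DecidableEq (HiggsLattice.PBond P 0)] (M : Model P N k) (dm2 : HiggsLattice.Site P 0 → ℝ) (l : Loc P k)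
    (κ : VertexKind) (x : HiggsLattice.Site P 0) : 0 ≤ UOf M dm2 l κ x :=
  Finset.sum_nonneg fun ξ _ => by split_ifs <;> simp [abs_nonneg]

/-- **E(G, {□(v)}, Φ_ext, A_ext) IN EXACT LABEL FORM, for EVERY graph of p18's model**: FILE 2's expression equals the sum over
label assignments `ξ : V(G) → Lab` of `Π_v ū_v(ξ_v)` times, species by species, the external components contracted against the signed
attachments of the external legs and ONE SIGNED EFFECTIVE KERNEL PER LINE (`Σ_{p,p′} σσ′K`: by §2 an entry, a `dK1`/`dK2`, or a `dKs`
of the line's propagator according as 0, 1 or 2 of its legs are differentiated). No absolute value has been taken.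
[cite: Balaban1983Higgs3, p.420] [cite: Balaban1983Higgs3, (2.11) p.426] -/
theorem graphAmp_eq_labelForm (G : Graph nbar) (M : Model P N k) (dm2 : Fin G.nV → HiggsLattice.Site P 0 → ℝ)
    (loc : Fin G.nV → Loc P k) (Po : OutPairing G)
    (Ks : SLine G → HiggsLattice.Site P 0 × Fin N → HiggsLattice.Site P 0 × Fin N → ℝ)
    (Kv : VLine G → HiggsLattice.PBond P 0 → HiggsLattice.PBond P 0 → ℝ)
    (Ko : Po.Line oRank → HiggsLattice.Site P k × Fin N → HiggsLattice.Site P k × Fin N → ℝ)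
    (Φ : (ExtSLeg G → HiggsLattice.Site P 0 × Fin N) → ℝ) (A : (ExtVLeg G → HiggsLattice.PBond P 0) → ℝ)
    (Ψ : (Po.Ext → HiggsLattice.Site P k × Fin N) → ℝ) :
    graphAmp G M dm2 loc Po Ks Kv Ko Φ A Ψ =
      ∑ ξ : Fin G.nV → Lab P N, (∏ i, ubOfKind M (dm2 i) (loc i) (G.kind i) (ξ i)) *
        (((∑ γ : ExtSLeg G → HiggsLattice.Site P 0 × Fin N,
              (∏ e : ExtSLeg G, sigSK M (G.kind e.1.1) e.1.2 (ξ e.1.1) (γ e)) * Φ γ) *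
            ∏ l : SLine G, ∑ p, ∑ p', sigSK M (G.kind l.1.1) l.1.2 (ξ l.1.1) p *
              sigSK M (G.kind ((sPairing G).mate l.1).1) ((sPairing G).mate l.1).2 (ξ ((sPairing G).mate l.1).1) p' * Ks l p p') *
          ((∑ ζ : ExtVLeg G → HiggsLattice.PBond P 0, (∏ e : ExtVLeg G, sigVK M (G.kind e.1.1) e.1.2 (ξ e.1.1) (ζ e)) * A ζ) *
            ∏ l : VLine G, ∑ b, ∑ b', sigVK M (G.kind l.1.1) l.1.2 (ξ l.1.1) b *
              sigVK M (G.kind ((vPairing G).mate l.1).1) ((vPairing G).mate l.1).2 (ξ ((vPairing G).mate l.1).1) b' * Kv l b b') *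
          ((∑ ο : Po.Ext → HiggsLattice.Site P k × Fin N, (∏ e : Po.Ext, sigOK k (G.kind e.1.1) e.1.2 (ξ e.1.1) (ο e)) * Ψ ο) *
            ∏ l : Po.Line oRank, ∑ r, ∑ r', sigOK k (G.kind l.1.1) l.1.2 (ξ l.1.1) r *
              sigOK k (G.kind (Po.mate l.1).1) (Po.mate l.1).2 (ξ (Po.mate l.1).1) r' * Ko l r r')) := by
  unfold graphAmp
  exact amp_eq_labelForm (rulesOf G M dm2 loc) basisE basisV basisE Po Ks Kv Ko Φ A Ψ (Ξ := fun _ => Lab P N)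
    (fun i => ubOfKind M (dm2 i) (loc i) (G.kind i)) (fun ℓ => sigSK M (G.kind ℓ.1) ℓ.2) (fun ℓ => sigVK M (G.kind ℓ.1) ℓ.2)
    (fun ℓ => sigOK k (G.kind ℓ.1) ℓ.2) (fun i aS aV aO => ruleOfKind_basis_labelForm M (dm2 i) (loc i) (G.kind i) aS aV aO)

/-- **THE FIRST ESTIMATE OF E(G, {□(v)}, Φ_ext, A_ext) IN SIGNED POSITION FORM, for EVERY graph of p18's model** (p. 426, with
each differentiation booked on its line): for any non-negative position kernels `K̄_l` dominating the SIGNED effective kernels of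
the lines between the positions of the labels of their endpoints — for a line at a differentiated leg a bound on `dK1`/`dK2`/`dKs`
of its propagator (§2), where (2.10) TOGETHER WITH its factor `(L^jη)⁻¹` per differentiation, i.e. (2.11), is fed in; for the
other lines entry bounds ((2.10), (2.12), (1.18)) — and any non-negative per-leg data dominating the signed external contractions:
`|E| ≤ Σ_{x : V(G) → T_η} Π_v U_v(x_v) · Π_{ext} n(x) · Π_{lines} K̄_l(x_{v_l}, x_{v′_l})` with the vertex functions `UOf` (no `η⁻¹`).
Same shape as FILE 12 §4's `abs_graphAmp_le_positionForm`. [cite: Balaban1983Higgs3, (2.13) p.426] [cite: Balaban1983Higgs3, (2.11) p.426]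
[cite: Balaban1983Higgs3, (2.14) p.427] -/
theorem abs_graphAmp_le_positionForm_signed (G : Graph nbar) (M : Model P N k)
    (dm2 : Fin G.nV → HiggsLattice.Site P 0 → ℝ) (loc : Fin G.nV → Loc P k) (Po : OutPairing G)
    (Ks : SLine G → HiggsLattice.Site P 0 × Fin N → HiggsLattice.Site P 0 × Fin N → ℝ)
    (Kv : VLine G → HiggsLattice.PBond P 0 → HiggsLattice.PBond P 0 → ℝ)
    (Ko : Po.Line oRank → HiggsLattice.Site P k × Fin N → HiggsLattice.Site P k × Fin N → ℝ)
    (Φ : (ExtSLeg G → HiggsLattice.Site P 0 × Fin N) → ℝ) (A : (ExtVLeg G → HiggsLattice.PBond P 0) → ℝ)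
    (Ψ : (Po.Ext → HiggsLattice.Site P k × Fin N) → ℝ)
    (KS : SLine G → HiggsLattice.Site P 0 → HiggsLattice.Site P 0 → ℝ) (hKS0 : ∀ l x x', 0 ≤ KS l x x')
    (hKs : ∀ (l : SLine G) (ξ₁ ξ₂ : Lab P N),
      |∑ p, ∑ p', sigSK M (G.kind l.1.1) l.1.2 ξ₁ p *
          sigSK M (G.kind ((sPairing G).mate l.1).1) ((sPairing G).mate l.1).2 ξ₂ p' * Ks l p p'| ≤ KS l ξ₁.pos ξ₂.pos)
    (KV : VLine G → HiggsLattice.Site P 0 → HiggsLattice.Site P 0 → ℝ) (hKV0 : ∀ l x x', 0 ≤ KV l x x')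
    (hKv : ∀ (l : VLine G) (ξ₁ ξ₂ : Lab P N),
      |∑ b, ∑ b', sigVK M (G.kind l.1.1) l.1.2 ξ₁ b *
          sigVK M (G.kind ((vPairing G).mate l.1).1) ((vPairing G).mate l.1).2 ξ₂ b' * Kv l b b'| ≤ KV l ξ₁.pos ξ₂.pos)
    (KO : Po.Line oRank → HiggsLattice.Site P 0 → HiggsLattice.Site P 0 → ℝ) (hKO0 : ∀ l x x', 0 ≤ KO l x x')
    (hKo : ∀ (l : Po.Line oRank) (ξ₁ ξ₂ : Lab P N),
      |∑ r, ∑ r', sigOK k (G.kind l.1.1) l.1.2 ξ₁ r * sigOK k (G.kind (Po.mate l.1).1) (Po.mate l.1).2 ξ₂ r' * Ko l r r'| ≤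
        KO l ξ₁.pos ξ₂.pos)
    (nS : ExtSLeg G → HiggsLattice.Site P 0 → ℝ) (hnS0 : ∀ e x, 0 ≤ nS e x)
    (hΦ : ∀ ξ : Fin G.nV → Lab P N,
      |∑ γ : ExtSLeg G → HiggsLattice.Site P 0 × Fin N, (∏ e : ExtSLeg G, sigSK M (G.kind e.1.1) e.1.2 (ξ e.1.1) (γ e)) * Φ γ| ≤
        ∏ e : ExtSLeg G, nS e (ξ e.1.1).pos)
    (nV : ExtVLeg G → HiggsLattice.Site P 0 → ℝ) (hnV0 : ∀ e x, 0 ≤ nV e x)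
    (hA : ∀ ξ : Fin G.nV → Lab P N,
      |∑ ζ : ExtVLeg G → HiggsLattice.PBond P 0, (∏ e : ExtVLeg G, sigVK M (G.kind e.1.1) e.1.2 (ξ e.1.1) (ζ e)) * A ζ| ≤
        ∏ e : ExtVLeg G, nV e (ξ e.1.1).pos)
    (nO : Po.Ext → HiggsLattice.Site P 0 → ℝ) (hnO0 : ∀ e x, 0 ≤ nO e x)
    (hΨ : ∀ ξ : Fin G.nV → Lab P N,
      |∑ ο : Po.Ext → HiggsLattice.Site P k × Fin N, (∏ e : Po.Ext, sigOK k (G.kind e.1.1) e.1.2 (ξ e.1.1) (ο e)) * Ψ ο| ≤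
        ∏ e : Po.Ext, nO e (ξ e.1.1).pos) :
    |graphAmp G M dm2 loc Po Ks Kv Ko Φ A Ψ| ≤
      ∑ x : Fin G.nV → HiggsLattice.Site P 0, (∏ i, UOf M (dm2 i) (loc i) (G.kind i) (x i)) *
        (((∏ e : ExtSLeg G, nS e (x e.1.1)) * ∏ l : SLine G, KS l (x l.1.1) (x ((sPairing G).mate l.1).1)) *
          ((∏ e : ExtVLeg G, nV e (x e.1.1)) * ∏ l : VLine G, KV l (x l.1.1) (x ((vPairing G).mate l.1).1)) *
          ((∏ e : Po.Ext, nO e (x e.1.1)) * ∏ l : Po.Line oRank, KO l (x l.1.1) (x (Po.mate l.1).1))) := by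
  unfold graphAmp
  exact abs_amp_le_positionForm_signed (rulesOf G M dm2 loc) basisE basisV basisE Po Ks Kv Ko Φ A Ψ (Ξ := fun _ => Lab P N)
    (fun i => ubOfKind M (dm2 i) (loc i) (G.kind i)) (fun ℓ => sigSK M (G.kind ℓ.1) ℓ.2) (fun ℓ => sigVK M (G.kind ℓ.1) ℓ.2)
    (fun ℓ => sigOK k (G.kind ℓ.1) ℓ.2) (fun i aS aV aO => ruleOfKind_basis_labelForm M (dm2 i) (loc i) (G.kind i) aS aV aO)
    (fun _ ξ => ξ.pos) (fun i => UOf M (dm2 i) (loc i) (G.kind i)) (fun i x => le_of_eq rfl)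
    KS hKS0 (fun l ξ₁ ξ₂ => hKs l ξ₁ ξ₂) KV hKV0 (fun l ξ₁ ξ₂ => hKv l ξ₁ ξ₂) KO hKO0 (fun l ξ₁ ξ₂ => hKo l ξ₁ ξ₂)
    nS hnS0 hΦ nV hnV0 hA nO hnO0 hΨ

/-- **`|E(G, {□(v)}, Φ_ext, A_ext)| ≤ Σ_x Π_v U_v(x_v) · Π_{l ∈ G} K̄_l(x_{v_l}, x_{v′_l})` in (2.11) currency** — the signed position form
in the one-line-type shape of (2.13)/(2.14) (FILE 12 §6): one vertex function `U_v = UOf_v · extAt_v` per vertex, one position kernel per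
line of `Lines G Po`. [cite: Balaban1983Higgs3, (2.13) p.426] [cite: Balaban1983Higgs3, (2.14) p.427] -/
theorem abs_graphAmp_le_lines_signed (G : Graph nbar) (M : Model P N k) (dm2 : Fin G.nV → HiggsLattice.Site P 0 → ℝ)
    (loc : Fin G.nV → Loc P k) (Po : OutPairing G)
    (Ks : SLine G → HiggsLattice.Site P 0 × Fin N → HiggsLattice.Site P 0 × Fin N → ℝ)
    (Kv : VLine G → HiggsLattice.PBond P 0 → HiggsLattice.PBond P 0 → ℝ)
    (Ko : Po.Line oRank → HiggsLattice.Site P k × Fin N → HiggsLattice.Site P k × Fin N → ℝ)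
    (Φ : (ExtSLeg G → HiggsLattice.Site P 0 × Fin N) → ℝ) (A : (ExtVLeg G → HiggsLattice.PBond P 0) → ℝ)
    (Ψ : (Po.Ext → HiggsLattice.Site P k × Fin N) → ℝ)
    (KS : SLine G → HiggsLattice.Site P 0 → HiggsLattice.Site P 0 → ℝ) (hKS0 : ∀ l x x', 0 ≤ KS l x x')
    (hKs : ∀ (l : SLine G) (ξ₁ ξ₂ : Lab P N),
      |∑ p, ∑ p', sigSK M (G.kind l.1.1) l.1.2 ξ₁ p *
          sigSK M (G.kind ((sPairing G).mate l.1).1) ((sPairing G).mate l.1).2 ξ₂ p' * Ks l p p'| ≤ KS l ξ₁.pos ξ₂.pos)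
    (KV : VLine G → HiggsLattice.Site P 0 → HiggsLattice.Site P 0 → ℝ) (hKV0 : ∀ l x x', 0 ≤ KV l x x')
    (hKv : ∀ (l : VLine G) (ξ₁ ξ₂ : Lab P N),
      |∑ b, ∑ b', sigVK M (G.kind l.1.1) l.1.2 ξ₁ b *
          sigVK M (G.kind ((vPairing G).mate l.1).1) ((vPairing G).mate l.1).2 ξ₂ b' * Kv l b b'| ≤ KV l ξ₁.pos ξ₂.pos)
    (KO : Po.Line oRank → HiggsLattice.Site P 0 → HiggsLattice.Site P 0 → ℝ) (hKO0 : ∀ l x x', 0 ≤ KO l x x')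
    (hKo : ∀ (l : Po.Line oRank) (ξ₁ ξ₂ : Lab P N),
      |∑ r, ∑ r', sigOK k (G.kind l.1.1) l.1.2 ξ₁ r * sigOK k (G.kind (Po.mate l.1).1) (Po.mate l.1).2 ξ₂ r' * Ko l r r'| ≤
        KO l ξ₁.pos ξ₂.pos)
    (nS : ExtSLeg G → HiggsLattice.Site P 0 → ℝ) (hnS0 : ∀ e x, 0 ≤ nS e x)
    (hΦ : ∀ ξ : Fin G.nV → Lab P N,
      |∑ γ : ExtSLeg G → HiggsLattice.Site P 0 × Fin N, (∏ e : ExtSLeg G, sigSK M (G.kind e.1.1) e.1.2 (ξ e.1.1) (γ e)) * Φ γ| ≤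
        ∏ e : ExtSLeg G, nS e (ξ e.1.1).pos)
    (nV : ExtVLeg G → HiggsLattice.Site P 0 → ℝ) (hnV0 : ∀ e x, 0 ≤ nV e x)
    (hA : ∀ ξ : Fin G.nV → Lab P N,
      |∑ ζ : ExtVLeg G → HiggsLattice.PBond P 0, (∏ e : ExtVLeg G, sigVK M (G.kind e.1.1) e.1.2 (ξ e.1.1) (ζ e)) * A ζ| ≤
        ∏ e : ExtVLeg G, nV e (ξ e.1.1).pos)
    (nO : Po.Ext → HiggsLattice.Site P 0 → ℝ) (hnO0 : ∀ e x, 0 ≤ nO e x)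
    (hΨ : ∀ ξ : Fin G.nV → Lab P N,
      |∑ ο : Po.Ext → HiggsLattice.Site P k × Fin N, (∏ e : Po.Ext, sigOK k (G.kind e.1.1) e.1.2 (ξ e.1.1) (ο e)) * Ψ ο| ≤
        ∏ e : Po.Ext, nO e (ξ e.1.1).pos) :
    |graphAmp G M dm2 loc Po Ks Kv Ko Φ A Ψ| ≤
      ∑ x : Fin G.nV → HiggsLattice.Site P 0,
        (∏ i, UOf M (dm2 i) (loc i) (G.kind i) (x i) * extAt Po nS nV nO i (x i)) *
          ∏ l : Lines G Po, lineKer Po KS KV KO l (x (lineSrc Po l)) (x (lineTgt Po l)) := by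
  refine (abs_graphAmp_le_positionForm_signed G M dm2 loc Po Ks Kv Ko Φ A Ψ KS hKS0 hKs KV hKV0 hKv KO hKO0 hKo nS hnS0 hΦ
    nV hnV0 hA nO hnO0 hΨ).trans (le_of_eq (Finset.sum_congr rfl fun x _ => ?_))
  exact positionForm_eq_lines Po (fun i => UOf M (dm2 i) (loc i) (G.kind i)) nS nV nO KS KV KO x

/-- **THE EXPRESSION OF A GRAPH ENTERS (2.13) IN PRINT'S CURRENCY**: as FILE 12 §7.3's `abs_graphAmp_le_ampE`, but from the SIGNED position
form — the kernel families `K_l(t; x, x′)` now dominate the signed effective kernels (`dK1`/`dK2`/`dKs` for lines at differentiated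
legs, entries otherwise), so in p19's `K_le` the line dimension `a_l` may carry print's `−1` per differentiation ((2.11)), and the
vertex functions `U_v = UOf_v · extAt_v` carry no `η⁻¹`, so p19's `e_v ≥ 0` is met by the printed powers (`η^{n+n′−1}` for (1.8)).
The packaged amplitude is p19's `ampOf`; p19's `Amp.abs_E_le` ∕ `Amp.ineq213` ((2.13), PROVED there) apply to it.
[cite: Balaban1983Higgs3, (2.13) p.426] [cite: Balaban1983Higgs3, (2.11) p.426] [cite: Balaban1983Higgs3, (2.14) p.427] -/
theorem abs_graphAmp_le_ampE_signed (G : Graph nbar) (Mh : Model P N k) (dm2 : Fin G.nV → HiggsLattice.Site P 0 → ℝ)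
    (loc : Fin G.nV → Loc P k) (Po : OutPairing G)
    (Ks : SLine G → HiggsLattice.Site P 0 × Fin N → HiggsLattice.Site P 0 × Fin N → ℝ)
    (Kv : VLine G → HiggsLattice.PBond P 0 → HiggsLattice.PBond P 0 → ℝ)
    (Ko : Po.Line oRank → HiggsLattice.Site P k × Fin N → HiggsLattice.Site P k × Fin N → ℝ)
    (Φ : (ExtSLeg G → HiggsLattice.Site P 0 × Fin N) → ℝ) (A : (ExtVLeg G → HiggsLattice.PBond P 0) → ℝ)
    (Ψ : (Po.Ext → HiggsLattice.Site P k × Fin N) → ℝ)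
    {m : ℕ} (eL : Fin m ≃ Lines G Po) (e : Fin G.nV → ℝ) (a : Fin m → ℝ) (d L : ℕ) (δ₀ : ℝ) (hd : 0 < d) (hL : 2 ≤ L)
    (hδ : 0 < δ₀) (j : Fin m → ℕ) (K : Fin m → ℕ → HiggsLattice.Site P 0 → HiggsLattice.Site P 0 → ℝ)
    (hK0 : ∀ i t x x', 0 ≤ K i t x x')
    (hKs : ∀ (l : SLine G) (ξ₁ ξ₂ : Lab P N),
      |∑ p, ∑ p', sigSK Mh (G.kind l.1.1) l.1.2 ξ₁ p *
          sigSK Mh (G.kind ((sPairing G).mate l.1).1) ((sPairing G).mate l.1).2 ξ₂ p' * Ks l p p'| ≤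
        K (eL.symm (Sum.inl l)) (j (eL.symm (Sum.inl l))) ξ₁.pos ξ₂.pos)
    (hKv : ∀ (l : VLine G) (ξ₁ ξ₂ : Lab P N),
      |∑ b, ∑ b', sigVK Mh (G.kind l.1.1) l.1.2 ξ₁ b *
          sigVK Mh (G.kind ((vPairing G).mate l.1).1) ((vPairing G).mate l.1).2 ξ₂ b' * Kv l b b'| ≤
        K (eL.symm (Sum.inr (Sum.inl l))) (j (eL.symm (Sum.inr (Sum.inl l)))) ξ₁.pos ξ₂.pos)
    (hKo : ∀ (l : Po.Line oRank) (ξ₁ ξ₂ : Lab P N),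
      |∑ r, ∑ r', sigOK k (G.kind l.1.1) l.1.2 ξ₁ r * sigOK k (G.kind (Po.mate l.1).1) (Po.mate l.1).2 ξ₂ r' * Ko l r r'| ≤
        K (eL.symm (Sum.inr (Sum.inr l))) (j (eL.symm (Sum.inr (Sum.inr l)))) ξ₁.pos ξ₂.pos)
    (nS : ExtSLeg G → HiggsLattice.Site P 0 → ℝ) (hnS0 : ∀ e x, 0 ≤ nS e x)
    (hΦ : ∀ ξ : Fin G.nV → Lab P N,
      |∑ γ : ExtSLeg G → HiggsLattice.Site P 0 × Fin N, (∏ e : ExtSLeg G, sigSK Mh (G.kind e.1.1) e.1.2 (ξ e.1.1) (γ e)) * Φ γ| ≤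
        ∏ e : ExtSLeg G, nS e (ξ e.1.1).pos)
    (nV : ExtVLeg G → HiggsLattice.Site P 0 → ℝ) (hnV0 : ∀ e x, 0 ≤ nV e x)
    (hA : ∀ ξ : Fin G.nV → Lab P N,
      |∑ ζ : ExtVLeg G → HiggsLattice.PBond P 0, (∏ e : ExtVLeg G, sigVK Mh (G.kind e.1.1) e.1.2 (ξ e.1.1) (ζ e)) * A ζ| ≤
        ∏ e : ExtVLeg G, nV e (ξ e.1.1).pos)
    (nO : Po.Ext → HiggsLattice.Site P 0 → ℝ) (hnO0 : ∀ e x, 0 ≤ nO e x)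
    (hΨ : ∀ ξ : Fin G.nV → Lab P N,
      |∑ ο : Po.Ext → HiggsLattice.Site P k × Fin N, (∏ e : Po.Ext, sigOK k (G.kind e.1.1) e.1.2 (ξ e.1.1) (ο e)) * Ψ ο| ≤
        ∏ e : Po.Ext, nO e (ξ e.1.1).pos)
    (kk : ℕ) (box : Fin G.nV → Fin d → ℕ) (c : Fin G.nV → (Fin d → ℕ) → HiggsLattice.Site P 0)
    (hinj : ∀ v, Set.InjOn (c v) ↑(pts L (⟨kk, box v⟩ : Cube d)))
    (hsupp : ∀ v y, UOf Mh (dm2 v) (loc v) (G.kind v) y * extAt Po nS nV nO v y ≠ 0 →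
      ∃ ξ ∈ pts L (⟨kk, box v⟩ : Cube d), c v ξ = y)
    (C : Fin m → ℝ) (eRun lamRun : ℝ) (dv ds : Fin G.nV → ℕ) (NPhi NA : Fin G.nV → ℝ)
    (C_nonneg : ∀ l, 0 ≤ C l) (eRun_nonneg : 0 ≤ eRun) (lamRun_nonneg : 0 ≤ lamRun) (NPhi_nonneg : ∀ v, 0 ≤ NPhi v)
    (NA_nonneg : ∀ v, 0 ≤ NA v) (e_nonneg : ∀ v, 0 ≤ e v)
    (conn : LinesConnect (fun i => lineSrc Po (eL i)) (fun i => lineTgt Po (eL i)))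
    (u_le : ∀ v ξ, |((L : ℝ) ^ kk) ^ d * (UOf Mh (dm2 v) (loc v) (G.kind v) (c v ξ) * extAt Po nS nV nO v (c v ξ))| ≤
      eRun ^ dv v * lamRun ^ ds v * NPhi v * NA v * (((L : ℝ) ^ kk)⁻¹) ^ e v)
    (K_le : ∀ l t, t < kk → ∀ ξ ∈ pts L (⟨kk, box (lineSrc Po (eL l))⟩ : Cube d), ∀ ξ' ∈ pts L (⟨kk, box (lineTgt Po (eL l))⟩ : Cube d),
      |K l t (c (lineSrc Po (eL l)) ξ) (c (lineTgt Po (eL l)) ξ')| ≤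
        C l * (modelOfGraph G Po eL e a d L δ₀ hd hL hδ).sc kk t ^ a l *
          Real.exp (-(2 * δ₀ / (modelOfGraph G Po eL e a d L δ₀ hd hL hδ).sc kk t * (((L : ℝ) ^ kk)⁻¹ * (supDist ξ ξ' : ℝ))))) :
    |graphAmp G Mh dm2 loc Po Ks Kv Ko Φ A Ψ| ≤
      (ampOf (modelOfGraph G Po eL e a d L δ₀ hd hL hδ) kk box c
        (fun v y => UOf Mh (dm2 v) (loc v) (G.kind v) y * extAt Po nS nV nO v y) K C eRun lamRun dv ds NPhi NA
        C_nonneg eRun_nonneg lamRun_nonneg NPhi_nonneg NA_nonneg e_nonneg conn u_le K_le).E j := by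
  rw [E_ampOf]
  have h13 := abs_graphAmp_le_lines_signed G Mh dm2 loc Po Ks Kv Ko Φ A Ψ
    (fun l => K (eL.symm (Sum.inl l)) (j (eL.symm (Sum.inl l)))) (fun l x x' => hK0 _ _ x x') hKs
    (fun l => K (eL.symm (Sum.inr (Sum.inl l))) (j (eL.symm (Sum.inr (Sum.inl l))))) (fun l x x' => hK0 _ _ x x') hKv
    (fun l => K (eL.symm (Sum.inr (Sum.inr l))) (j (eL.symm (Sum.inr (Sum.inr l))))) (fun l x x' => hK0 _ _ x x') hKo
    nS hnS0 hΦ nV hnV0 hA nO hnO0 hΨ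
  refine h13.trans (le_of_eq ?_)
  have hker : ∀ (x : Fin G.nV → HiggsLattice.Site P 0),
      ∏ l : Lines G Po, lineKer Po (fun l => K (eL.symm (Sum.inl l)) (j (eL.symm (Sum.inl l))))
          (fun l => K (eL.symm (Sum.inr (Sum.inl l))) (j (eL.symm (Sum.inr (Sum.inl l)))))
          (fun l => K (eL.symm (Sum.inr (Sum.inr l))) (j (eL.symm (Sum.inr (Sum.inr l))))) l (x (lineSrc Po l)) (x (lineTgt Po l)) =
        ∏ i : Fin m, K i (j i) (x (lineSrc Po (eL i))) (x (lineTgt Po (eL i))) := by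
    intro x
    refine (Fintype.prod_equiv eL _ _ fun i => ?_).symm
    rcases h : eL i with l | l | l <;> simp only [lineKer, ← h, Equiv.symm_apply_apply]
  simp only [hker]
  exact sum_positions_eq_boxSum L kk box c hinj _ hsupp (fun i => lineSrc Po (eL i)) (fun i => lineTgt Po (eL i))
    (fun i => K i (j i))

/-! ### The vertex function of (1.8) in the signed form: `η^{n+n′−1}`, no `η⁻¹` -/

/-- kernel: a component of `q^m e_{c′}` is at most `1` (`|q| ≦ 1`). [cite: Balaban1982Higgs1, (1.7) p.605] -/
private theorem abs_qpow_single_apply_le_one (C : HiggsLattice.ChargeData N) (m : ℕ) (c c' : Fin N) :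
    |(C.q ^ m) (EuclideanSpace.single c' (1 : ℝ)) c| ≤ 1 := by
  rw [← Real.norm_eq_abs]
  refine (PiLp.norm_apply_le ((C.q ^ m) (EuclideanSpace.single c' (1 : ℝ))) c).trans
    ((norm_qpow_apply_le C m _).trans ?_)
  rw [PiLp.norm_single, norm_one]

/-- **The vertex function of (1.8)_{n,n′} in the signed form is `N²·η` times FILE 12 §3's `u18`** — i.e.
`UOf ≤ N² |e|^{n+n′} η^{n+n′−1}/(n!n′!) · η^d |g_k(x)|^n · Σ_μ [⟨x,μ⟩∈S]|w||Ã|^{n′}`: the factor `η⁻¹` that FILE 12 §3 paid for the difference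
quotient is ABSENT (it sits in the line's `dK1`/`dKs`, where (2.11) accounts for it as `(L^jη)⁻¹`), so for (1.8)_{1,0} and (1.8)_{0,1}
the `η`-power of the vertex is `η^0 · η^d` — p19's `e_v ≥ 0` is met. (`N²` counts the two free channels against `|(q^m)_{cc′}| ≦ 1`.)
[cite: Balaban1983Higgs3, (1.8) p.413] [cite: Balaban1983Higgs3, (2.11) p.426] [cite: Balaban1983Higgs3, (2.14) p.427] -/
theorem UOf_v18_le (M : Model P N k) (dm2 : HiggsLattice.Site P 0 → ℝ) (l : Loc P k) (n n' : ℕ) (x : HiggsLattice.Site P 0) :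
    UOf M dm2 l (.v18 n n') x ≤ (N : ℝ) ^ 2 * P.mesh 0 * u18 M.C M.g M.At n n' M.S l.wB x := by
  have hη : 0 < P.mesh 0 := P.mesh_pos 0
  -- the non-negative bond weight against which every label at `b` is bounded
  set T : HiggsLattice.PBond P 0 → ℝ := fun b =>
    |M.C.e| ^ (n + n') * (P.mesh 0 ^ ((n + n' : ℤ) - 1) / ((n.factorial : ℝ) * n'.factorial)) *
      ((if b ∈ M.S then (1 : ℝ) else 0) * (|l.wB b| * (P.mesh 0 ^ P.d * |M.g b.src| ^ n * |M.At b| ^ n'))) with hT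
  have hT0 : ∀ b, 0 ≤ T b := fun b => by
    rw [hT]
    have : 0 ≤ P.mesh 0 ^ ((n + n' : ℤ) - 1) := zpow_nonneg hη.le _
    have : 0 ≤ (if b ∈ M.S then (1 : ℝ) else 0) := by split_ifs <;> norm_num
    positivity
  -- termwise bound at a bond label
  have hterm : ∀ (b : HiggsLattice.PBond P 0) (c c' : Fin N),
      (if Lab.pos ((Sum.inr b, c, c') : Lab P N) = x then |ubOfKind M dm2 l (.v18 n n') (Sum.inr b, c, c')| else 0) ≤
        attB x b * T b := by
    intro b c c'
    have hpos : Lab.pos ((Sum.inr b, c, c') : Lab P N) = b.src := rfl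
    rw [hpos]
    unfold attB
    by_cases hb : b.src = x
    · rw [if_pos hb, if_pos hb, one_mul]
      by_cases hS : b ∈ M.S
      · have hub : ubOfKind M dm2 l (.v18 n n') (Sum.inr b, c, c') =
            (M.C.q ^ (n + n')) (EuclideanSpace.single c' (1 : ℝ)) c *
              (M.C.e ^ (n + n') * ((-1 : ℝ) ^ (n + n') * P.mesh 0 ^ ((n + n' : ℤ) - 1) / ((n.factorial : ℝ) * n'.factorial)) *
                (l.wB b * (P.mesh 0 ^ P.d * M.g b.src ^ n * M.At b ^ n'))) := by
          simp only [ubOfKind, hS, if_true, one_mul]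
          ring
        have hTb : T b = |M.C.e ^ (n + n') * ((-1 : ℝ) ^ (n + n') * P.mesh 0 ^ ((n + n' : ℤ) - 1) /
            ((n.factorial : ℝ) * n'.factorial)) * (l.wB b * (P.mesh 0 ^ P.d * M.g b.src ^ n * M.At b ^ n'))| := by
          rw [hT]
          simp only [hS, if_true, one_mul, abs_mul, abs_div, abs_pow, abs_neg, abs_one, one_pow, Nat.abs_cast,
            abs_zpow, abs_of_pos hη]
        rw [hub, abs_mul, hTb]
        exact mul_le_of_le_one_left (abs_nonneg _) (abs_qpow_single_apply_le_one M.C (n + n') c c')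
      · have hub : ubOfKind M dm2 l (.v18 n n') (Sum.inr b, c, c') = 0 := by
          simp only [ubOfKind, hS, if_false, zero_mul, mul_zero]
        rw [hub, abs_zero]
        exact hT0 b
    · rw [if_neg hb, if_neg hb, zero_mul]
  unfold UOf
  rw [sum_Lab]
  have h0 : ∑ x' : HiggsLattice.Site P 0, ∑ c : Fin N, ∑ c' : Fin N,
      (if Lab.pos ((Sum.inl x', c, c') : Lab P N) = x then |ubOfKind M dm2 l (.v18 n n') (Sum.inl x', c, c')| else 0) = 0 := by
    refine Finset.sum_eq_zero fun x' _ => Finset.sum_eq_zero fun c _ => Finset.sum_eq_zero fun c' _ => ?_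
    simp [ubOfKind]
  rw [h0, zero_add]
  -- sum the termwise bound: `N²` channels, the `d` bonds at `x`
  have hsum : ∑ b, ∑ c : Fin N, ∑ c' : Fin N,
      (if Lab.pos ((Sum.inr b, c, c') : Lab P N) = x then |ubOfKind M dm2 l (.v18 n n') (Sum.inr b, c, c')| else 0) ≤
        ∑ b, ∑ _c : Fin N, ∑ _c' : Fin N, attB x b * T b :=
    Finset.sum_le_sum fun b _ => Finset.sum_le_sum fun c _ => Finset.sum_le_sum fun c' _ => hterm b c c'
  refine hsum.trans (le_of_eq ?_)
  simp only [Finset.sum_const, Finset.card_univ, Fintype.card_fin, nsmul_eq_mul]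
  rw [show ∑ b, (N : ℝ) * ((N : ℝ) * (attB x b * T b)) = (N : ℝ) ^ 2 * ∑ b, attB x b * T b by
    rw [Finset.mul_sum]; exact Finset.sum_congr rfl fun b _ => by ring]
  rw [sum_attB_mul, hT]
  unfold u18 bondData
  rw [Finset.mul_sum, Finset.mul_sum, Finset.mul_sum, Finset.mul_sum]
  refine Finset.sum_congr rfl fun μ _ => ?_
  field_simp

/-! ### The vertex functions of the signed form versus FILE 12's: `UOf_κ ≤ N²·η^{diffCount κ}·uOfKind_κ` (all nine kinds) -/

/-- kernel: a component of `T e_{c′}` is at most `1` for an operator of norm `≦ 1`. [cite: Balaban1983Higgs3, p.426] -/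
private theorem abs_op_single_apply_le_one (T : HiggsCovariance.E N →L[ℝ] HiggsCovariance.E N) (hT : ‖T‖ ≤ 1) (c c' : Fin N) :
    |T (EuclideanSpace.single c' (1 : ℝ)) c| ≤ 1 := by
  rw [← Real.norm_eq_abs]
  refine (PiLp.norm_apply_le (T (EuclideanSpace.single c' (1 : ℝ))) c).trans ((T.le_opNorm _).trans ?_)
  rw [PiLp.norm_single, norm_one, mul_one]
  exact hT

/-- kernel: a component of `q^m U(a) e_c` is at most `1` (`|q| ≦ 1`, `|U| = 1`). [cite: Balaban1983Higgs3, p.426] -/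
private theorem abs_qpow_U_single_apply_le_one (C : HiggsLattice.ChargeData N) (m : ℕ) (a : ℝ) (c c' : Fin N) :
    |((C.q ^ m).comp (C.U 1 a)) (EuclideanSpace.single c (1 : ℝ)) c'| ≤ 1 := by
  rw [← Real.norm_eq_abs, ContinuousLinearMap.comp_apply]
  refine (PiLp.norm_apply_le _ c').trans ((norm_qpow_apply_le C m _).trans ?_)
  rw [norm_U_apply, PiLp.norm_single, norm_one]

/-- kernel: a component of `(q^m R) U(a) e_c` is at most `1` for `‖q^m R‖ ≦ 1`. [cite: Balaban1983Higgs3, p.426] -/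
private theorem abs_op_U_single_apply_le_one (C : HiggsLattice.ChargeData N) (T : HiggsCovariance.E N →L[ℝ] HiggsCovariance.E N)
    (hT : ‖T‖ ≤ 1) (a : ℝ) (c c' : Fin N) : |(T.comp (C.U 1 a)) (EuclideanSpace.single c (1 : ℝ)) c'| ≤ 1 := by
  rw [← Real.norm_eq_abs, ContinuousLinearMap.comp_apply]
  refine (PiLp.norm_apply_le _ c').trans ((T.le_opNorm _).trans ?_)
  rw [norm_U_apply, PiLp.norm_single, norm_one, mul_one]
  exact hT

/-- **Site kinds**: if the coefficient vanishes on bond labels and is bounded on site labels by `S`, then `UOf ≤ N²·S`.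
[cite: Balaban1983Higgs3, (2.13) p.426] -/
theorem UOf_le_of_site (M : Model P N k) (dm2 : HiggsLattice.Site P 0 → ℝ) (l : Loc P k) (κ : VertexKind)
    (S : HiggsLattice.Site P 0 → ℝ) (hinr : ∀ b c c', ubOfKind M dm2 l κ (Sum.inr b, c, c') = 0)
    (hinl : ∀ x c c', |ubOfKind M dm2 l κ (Sum.inl x, c, c')| ≤ S x) (x : HiggsLattice.Site P 0) :
    UOf M dm2 l κ x ≤ (N : ℝ) ^ 2 * S x := by
  unfold UOf
  rw [sum_Lab]
  have h0 : ∑ b, ∑ c : Fin N, ∑ c' : Fin N,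
      (if Lab.pos ((Sum.inr b, c, c') : Lab P N) = x then |ubOfKind M dm2 l κ (Sum.inr b, c, c')| else 0) = 0 :=
    Finset.sum_eq_zero fun b _ => Finset.sum_eq_zero fun c _ => Finset.sum_eq_zero fun c' _ => by
      rw [hinr]; simp
  rw [h0, add_zero]
  have hterm : ∀ (x' : HiggsLattice.Site P 0) (c c' : Fin N),
      (if Lab.pos ((Sum.inl x', c, c') : Lab P N) = x then |ubOfKind M dm2 l κ (Sum.inl x', c, c')| else 0) ≤
        if x' = x then S x else 0 := by
    intro x' c c'
    have hpos : Lab.pos ((Sum.inl x', c, c') : Lab P N) = x' := rfl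
    rw [hpos]
    by_cases h : x' = x
    · rw [if_pos h, if_pos h, ← h]; exact hinl x' c c'
    · rw [if_neg h, if_neg h]
  refine (Finset.sum_le_sum fun x' _ => Finset.sum_le_sum fun c _ => Finset.sum_le_sum fun c' _ => hterm x' c c').trans
    (le_of_eq ?_)
  simp only [Finset.sum_const, Finset.card_univ, Fintype.card_fin, nsmul_eq_mul]
  rw [show (∑ x', (N : ℝ) * ((N : ℝ) * (if x' = x then S x else 0))) = (N : ℝ) ^ 2 * ∑ x', (if x' = x then S x else 0) by
    rw [Finset.mul_sum]; exact Finset.sum_congr rfl fun _ _ => by ring]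
  rw [Finset.sum_ite_eq' Finset.univ x]
  simp

/-- **Bond kinds**: if the coefficient vanishes on site labels and is bounded on bond labels by `T`, then
`UOf(x) ≤ N²·Σ_μ T⟨x,μ⟩`. [cite: Balaban1983Higgs3, (2.13) p.426] -/
theorem UOf_le_of_bond (M : Model P N k) (dm2 : HiggsLattice.Site P 0 → ℝ) (l : Loc P k) (κ : VertexKind)
    (T : HiggsLattice.PBond P 0 → ℝ) (hinl : ∀ x c c', ubOfKind M dm2 l κ (Sum.inl x, c, c') = 0)
    (hinr : ∀ b c c', |ubOfKind M dm2 l κ (Sum.inr b, c, c')| ≤ T b) (x : HiggsLattice.Site P 0) :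
    UOf M dm2 l κ x ≤ (N : ℝ) ^ 2 * ∑ μ : Fin P.d, T ⟨x, μ⟩ := by
  unfold UOf
  rw [sum_Lab]
  have h0 : ∑ x' : HiggsLattice.Site P 0, ∑ c : Fin N, ∑ c' : Fin N,
      (if Lab.pos ((Sum.inl x', c, c') : Lab P N) = x then |ubOfKind M dm2 l κ (Sum.inl x', c, c')| else 0) = 0 :=
    Finset.sum_eq_zero fun x' _ => Finset.sum_eq_zero fun c _ => Finset.sum_eq_zero fun c' _ => by
      rw [hinl]; simp
  rw [h0, zero_add]
  have hterm : ∀ (b : HiggsLattice.PBond P 0) (c c' : Fin N),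
      (if Lab.pos ((Sum.inr b, c, c') : Lab P N) = x then |ubOfKind M dm2 l κ (Sum.inr b, c, c')| else 0) ≤ attB x b * T b := by
    intro b c c'
    have hpos : Lab.pos ((Sum.inr b, c, c') : Lab P N) = b.src := rfl
    rw [hpos]
    unfold attB
    by_cases hb : b.src = x
    · rw [if_pos hb, if_pos hb, one_mul]; exact hinr b c c'
    · rw [if_neg hb, if_neg hb, zero_mul]
  refine (Finset.sum_le_sum fun b _ => Finset.sum_le_sum fun c _ => Finset.sum_le_sum fun c' _ => hterm b c c').trans
    (le_of_eq ?_)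
  simp only [Finset.sum_const, Finset.card_univ, Fintype.card_fin, nsmul_eq_mul]
  rw [show ∑ b, (N : ℝ) * ((N : ℝ) * (attB x b * T b)) = (N : ℝ) ^ 2 * ∑ b, attB x b * T b by
    rw [Finset.mul_sum]; exact Finset.sum_congr rfl fun b _ => by ring]
  rw [sum_attB_mul]

/-- (1.6): `UOf ≤ N²·u16`. [cite: Balaban1983Higgs3, (1.6) p.413] -/
theorem UOf_v16_le (M : Model P N k) (dm2 : HiggsLattice.Site P 0 → ℝ) (l : Loc P k) (x : HiggsLattice.Site P 0) :
    UOf M dm2 l .v16 x ≤ (N : ℝ) ^ 2 * u16 M.lamRun M.Ω₁ l.wS x := by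
  refine UOf_le_of_site M dm2 l .v16 (u16 M.lamRun M.Ω₁ l.wS) (fun b c c' => rfl) (fun x' c c' => le_of_eq ?_) x
  have hη : 0 < P.mesh 0 ^ P.d := pow_pos (P.mesh_pos 0) _
  simp only [ubOfKind, u16]
  by_cases h : x' ∈ M.Ω₁
  · simp only [h, if_true, one_mul, mul_one, abs_neg, abs_mul, abs_pow, abs_of_pos (P.mesh_pos 0)]
    ring
  · simp [h]

/-- (1.7): `UOf ≤ N²·u17`. [cite: Balaban1983Higgs3, (1.7) p.413] -/
theorem UOf_v17_le (M : Model P N k) (dm2 : HiggsLattice.Site P 0 → ℝ) (l : Loc P k) (x : HiggsLattice.Site P 0) :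
    UOf M dm2 l .v17 x ≤ (N : ℝ) ^ 2 * u17 dm2 M.ell M.Ω₁ l.wS x := by
  refine UOf_le_of_site M dm2 l .v17 (u17 dm2 M.ell M.Ω₁ l.wS) (fun b c c' => rfl) (fun x' c c' => ?_) x
  have hu : 0 ≤ u17 dm2 M.ell M.Ω₁ l.wS x' := u17_nonneg _ _ _ _ _
  simp only [ubOfKind]
  by_cases hc : c' = c
  · rw [if_pos hc]
    by_cases h : x' ∈ M.Ω₁
    · refine le_of_eq ?_
      simp only [h, if_true, one_mul, u17, mul_one, abs_mul, abs_neg, abs_div, abs_one, abs_two, abs_pow,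
        abs_of_pos (P.mesh_pos 0)]
      rw [sq_abs]
      ring
    · simp only [h, if_false, zero_mul, mul_zero, abs_zero]
      exact hu
  · rw [if_neg hc, abs_zero]
    exact hu

/-- (1.9): `UOf ≤ N²·η·u19` (the differentiated kind: one `η⁻¹` of FILE 12 removed). [cite: Balaban1983Higgs3, (1.9) p.413] -/
theorem UOf_v19_le (M : Model P N k) (dm2 : HiggsLattice.Site P 0 → ℝ) (l : Loc P k) (n nb : ℕ) (x : HiggsLattice.Site P 0) :
    UOf M dm2 l (.v19 n nb) x ≤ (N : ℝ) ^ 2 * P.mesh 0 * u19 M.C M.g M.At nb n M.S l.wB x := by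
  have hη : 0 < P.mesh 0 := P.mesh_pos 0
  set T : HiggsLattice.PBond P 0 → ℝ := fun b =>
    |M.C.e| ^ (n + nb + 1) * (P.mesh 0 ^ (n + nb) / ((n.factorial : ℝ) * (nb + 1).factorial)) *
      ((if b ∈ M.S then (1 : ℝ) else 0) * (|l.wB b| * (P.mesh 0 ^ P.d * |M.g b.src| ^ n * |M.At b| ^ (nb + 1)))) with hT
  have hT0 : ∀ b, 0 ≤ T b := fun b => by
    rw [hT]
    have : 0 ≤ (if b ∈ M.S then (1 : ℝ) else 0) := by split_ifs <;> norm_num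
    positivity
  refine (UOf_le_of_bond M dm2 l (.v19 n nb) T (fun x c c' => rfl) (fun b c c' => ?_) x).trans (le_of_eq ?_)
  · by_cases hS : b ∈ M.S
    · have hub : ubOfKind M dm2 l (.v19 n nb) (Sum.inr b, c, c') =
          (M.C.q ^ (n + nb + 1) * remTensor M.C nb M.At b) (EuclideanSpace.single c' (1 : ℝ)) c *
            (M.C.e ^ (n + nb + 1) * ((-1 : ℝ) ^ (n + nb + 1) * P.mesh 0 ^ (n + nb) / ((n.factorial : ℝ) * (nb + 1).factorial)) *
              (l.wB b * (P.mesh 0 ^ P.d * M.g b.src ^ n * M.At b ^ (nb + 1)))) := by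
        simp only [ubOfKind, hS, if_true, one_mul]
        ring
      have hTb : T b = |M.C.e ^ (n + nb + 1) * ((-1 : ℝ) ^ (n + nb + 1) * P.mesh 0 ^ (n + nb) /
          ((n.factorial : ℝ) * (nb + 1).factorial)) * (l.wB b * (P.mesh 0 ^ P.d * M.g b.src ^ n * M.At b ^ (nb + 1)))| := by
        rw [hT]
        simp only [hS, if_true, one_mul, abs_mul, abs_div, abs_pow, abs_neg, abs_one, one_pow, Nat.abs_cast,
          abs_of_pos hη]
      rw [hub, abs_mul, hTb]
      exact mul_le_of_le_one_left (abs_nonneg _)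
        (abs_op_single_apply_le_one _ (norm_qpow_mul_remTensor_le_one M.C (n + nb + 1) nb M.At b) c c')
    · have hub : ubOfKind M dm2 l (.v19 n nb) (Sum.inr b, c, c') = 0 := by
        simp only [ubOfKind, hS, if_false, zero_mul, mul_zero]
      rw [hub, abs_zero]
      exact hT0 b
  · rw [hT]
    unfold u19 bondData
    simp only [Finset.mul_sum]
    refine Finset.sum_congr rfl fun μ _ => ?_
    field_simp

/-- (1.10): `UOf ≤ N²·u110`. [cite: Balaban1983Higgs3, (1.10) p.413] -/
theorem UOf_v110_le (M : Model P N k) (dm2 : HiggsLattice.Site P 0 → ℝ) (l : Loc P k) (n n' : ℕ) (x : HiggsLattice.Site P 0) :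
    UOf M dm2 l (.v110 n n') x ≤ (N : ℝ) ^ 2 * u110 M.C M.g M.At n n' M.S l.wB x := by
  have hη : 0 < P.mesh 0 := P.mesh_pos 0
  set T : HiggsLattice.PBond P 0 → ℝ := fun b =>
    |M.C.e| ^ (n + n') * (P.mesh 0 ^ ((n + n' : ℤ) - 2) / ((n.factorial : ℝ) * n'.factorial)) *
      ((if b ∈ M.S then (1 : ℝ) else 0) * (|l.wB b| * (P.mesh 0 ^ P.d * |M.g b.src| ^ n * |M.At b| ^ n'))) with hT
  have hT0 : ∀ b, 0 ≤ T b := fun b => by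
    rw [hT]
    have : 0 ≤ P.mesh 0 ^ ((n + n' : ℤ) - 2) := zpow_nonneg hη.le _
    have : 0 ≤ (if b ∈ M.S then (1 : ℝ) else 0) := by split_ifs <;> norm_num
    positivity
  refine (UOf_le_of_bond M dm2 l (.v110 n n') T (fun x c c' => rfl) (fun b c c' => ?_) x).trans (le_of_eq ?_)
  · by_cases hS : b ∈ M.S
    · have hub : ubOfKind M dm2 l (.v110 n n') (Sum.inr b, c, c') =
          (M.C.q ^ (n + n')) (EuclideanSpace.single c' (1 : ℝ)) c *
            (M.C.e ^ (n + n') * (P.mesh 0 ^ ((n + n' : ℤ) - 2) / ((n.factorial : ℝ) * n'.factorial)) *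
              (l.wB b * (P.mesh 0 ^ P.d * M.g b.src ^ n * M.At b ^ n'))) := by
        simp only [ubOfKind, hS, if_true, one_mul]
        ring
      have hTb : T b = |M.C.e ^ (n + n') * (P.mesh 0 ^ ((n + n' : ℤ) - 2) / ((n.factorial : ℝ) * n'.factorial)) *
          (l.wB b * (P.mesh 0 ^ P.d * M.g b.src ^ n * M.At b ^ n'))| := by
        rw [hT]
        simp only [hS, if_true, one_mul, abs_mul, abs_div, abs_pow, Nat.abs_cast, abs_zpow, abs_of_pos hη]
      rw [hub, abs_mul, hTb]
      exact mul_le_of_le_one_left (abs_nonneg _)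
        (abs_op_single_apply_le_one _ (B3VertexTensorBounds.norm_q_pow_le_one M.C (n + n')) c c')
    · have hub : ubOfKind M dm2 l (.v110 n n') (Sum.inr b, c, c') = 0 := by
        simp only [ubOfKind, hS, if_false, zero_mul, mul_zero]
      rw [hub, abs_zero]
      exact hT0 b
  · rw [hT]
    unfold u110 bondData
    simp only [Finset.mul_sum]
    refine Finset.sum_congr rfl fun μ _ => ?_
    ring

/-- (1.11): `UOf ≤ N²·u111`. [cite: Balaban1983Higgs3, (1.11) p.413] -/
theorem UOf_v111_le (M : Model P N k) (dm2 : HiggsLattice.Site P 0 → ℝ) (l : Loc P k) (n nb : ℕ) (x : HiggsLattice.Site P 0) :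
    UOf M dm2 l (.v111 n nb) x ≤ (N : ℝ) ^ 2 * u111 M.C M.g M.At nb n M.S l.wB x := by
  have hη : 0 < P.mesh 0 := P.mesh_pos 0
  set T : HiggsLattice.PBond P 0 → ℝ := fun b =>
    |M.C.e| ^ (n + nb + 1) * (P.mesh 0 ^ ((n + nb : ℤ) - 1) / ((n.factorial : ℝ) * (nb + 1).factorial)) *
      ((if b ∈ M.S then (1 : ℝ) else 0) * (|l.wB b| * (P.mesh 0 ^ P.d * |M.g b.src| ^ n * |M.At b| ^ (nb + 1)))) with hT
  have hT0 : ∀ b, 0 ≤ T b := fun b => by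
    rw [hT]
    have : 0 ≤ P.mesh 0 ^ ((n + nb : ℤ) - 1) := zpow_nonneg hη.le _
    have : 0 ≤ (if b ∈ M.S then (1 : ℝ) else 0) := by split_ifs <;> norm_num
    positivity
  refine (UOf_le_of_bond M dm2 l (.v111 n nb) T (fun x c c' => rfl) (fun b c c' => ?_) x).trans (le_of_eq ?_)
  · by_cases hS : b ∈ M.S
    · have hub : ubOfKind M dm2 l (.v111 n nb) (Sum.inr b, c, c') =
          (M.C.q ^ (n + nb + 1) * remTensor M.C nb M.At b) (EuclideanSpace.single c' (1 : ℝ)) c *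
            (M.C.e ^ (n + nb + 1) * ((-1 : ℝ) ^ (n + nb + 1) * P.mesh 0 ^ ((n + nb : ℤ) - 1) /
              ((n.factorial : ℝ) * (nb + 1).factorial)) *
              (l.wB b * (P.mesh 0 ^ P.d * M.g b.src ^ n * M.At b ^ (nb + 1)))) := by
        simp only [ubOfKind, hS, if_true, one_mul]
        ring
      have hTb : T b = |M.C.e ^ (n + nb + 1) * ((-1 : ℝ) ^ (n + nb + 1) * P.mesh 0 ^ ((n + nb : ℤ) - 1) /
          ((n.factorial : ℝ) * (nb + 1).factorial)) * (l.wB b * (P.mesh 0 ^ P.d * M.g b.src ^ n * M.At b ^ (nb + 1)))| := by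
        rw [hT]
        simp only [hS, if_true, one_mul, abs_mul, abs_div, abs_pow, abs_neg, abs_one, one_pow, Nat.abs_cast, abs_zpow,
          abs_of_pos hη]
      rw [hub, abs_mul, hTb]
      exact mul_le_of_le_one_left (abs_nonneg _)
        (abs_op_single_apply_le_one _ (norm_qpow_mul_remTensor_le_one M.C (n + nb + 1) nb M.At b) c c')
    · have hub : ubOfKind M dm2 l (.v111 n nb) (Sum.inr b, c, c') = 0 := by
        simp only [ubOfKind, hS, if_false, zero_mul, mul_zero]
      rw [hub, abs_zero]
      exact hT0 b
  · rw [hT]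
    unfold u111 bondData
    simp only [Finset.mul_sum]
    refine Finset.sum_congr rfl fun μ _ => ?_
    ring

/-- (1.13): `UOf ≤ N²·u113` (`|U| = 1`). [cite: Balaban1983Higgs3, (1.13) p.413] -/
theorem UOf_v113_le (M : Model P N k) (dm2 : HiggsLattice.Site P 0 → ℝ) (l : Loc P k) (x : HiggsLattice.Site P 0) :
    UOf M dm2 l .v113 x ≤ (N : ℝ) ^ 2 * u113 M.w M.Y l.wY x := by
  refine UOf_le_of_site M dm2 l .v113 (u113 M.w M.Y l.wY) (fun b c c' => rfl) (fun x' c c' => ?_) x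
  simp only [ubOfKind, u113]
  by_cases h : blockIter k x' ∈ M.Y
  · simp only [h, if_true, mul_one, abs_mul]
    rw [mul_comm |M.w|]
    refine mul_le_mul_of_nonneg_left ?_ (abs_nonneg _)
    have h1 : op113 M x' (EuclideanSpace.single c (1 : ℝ)) c' = -(M.w * (M.C.U 1 (M.β x')) (EuclideanSpace.single c (1 : ℝ)) c') := by
      rfl
    rw [h1, abs_neg, abs_mul]
    refine mul_le_of_le_one_right (abs_nonneg _) ?_
    rw [← Real.norm_eq_abs]
    refine (PiLp.norm_apply_le _ c').trans ?_
    rw [norm_U_apply, PiLp.norm_single, norm_one]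
  · simp only [h, if_false, zero_mul, mul_zero, abs_zero]
    exact le_rfl

/-- (1.14): `UOf ≤ N²·u114` (`|q| ≦ 1`, `|U| = 1`). [cite: Balaban1983Higgs3, (1.14) p.413] -/
theorem UOf_v114_le (M : Model P N k) (dm2 : HiggsLattice.Site P 0 → ℝ) (l : Loc P k) (n n' : ℕ) (x : HiggsLattice.Site P 0) :
    UOf M dm2 l (.v114 n n') x ≤ (N : ℝ) ^ 2 * u114 M.C M.w M.τ n n' M.Y l.wY x := by
  refine UOf_le_of_site M dm2 l (.v114 n n') (u114 M.C M.w M.τ n n' M.Y l.wY) (fun b c c' => rfl) (fun x' c c' => ?_) x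
  simp only [ubOfKind, u114]
  by_cases h : blockIter k x' ∈ M.Y
  · simp only [h, if_true, mul_one, abs_mul]
    have h1 : op114 M n n' x' (EuclideanSpace.single c (1 : ℝ)) c' =
        (-(M.C.e ^ (n + n') * (1 / ((n.factorial : ℝ) * n'.factorial))) * (M.w * M.τ x' ^ n')) *
          ((M.C.q ^ (n + n')).comp (M.C.U 1 (M.β x'))) (EuclideanSpace.single c (1 : ℝ)) c' := by
      simp only [op114, clm_smul_apply', PiLp.smul_apply, smul_eq_mul]
    rw [h1, abs_mul]
    have h2 : |(-(M.C.e ^ (n + n') * (1 / ((n.factorial : ℝ) * n'.factorial))) * (M.w * M.τ x' ^ n'))| =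
        |M.C.e| ^ (n + n') * (1 / ((n.factorial : ℝ) * n'.factorial)) * (|M.w| * |M.τ x'| ^ n') := by
      rw [abs_mul, abs_neg, abs_mul, abs_mul, abs_pow, abs_pow,
        abs_of_pos (by positivity : (0 : ℝ) < 1 / ((n.factorial : ℝ) * n'.factorial))]
    rw [h2]
    have h3 := abs_qpow_U_single_apply_le_one M.C (n + n') (M.β x') c c'
    have h4 : 0 ≤ |M.C.e| ^ (n + n') * (1 / ((n.factorial : ℝ) * n'.factorial)) * (|M.w| * |M.τ x'| ^ n') := by positivity
    calc |l.wY (blockIter k x')| * (|M.C.e| ^ (n + n') * (1 / ((n.factorial : ℝ) * n'.factorial)) * (|M.w| * |M.τ x'| ^ n') *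
          |((M.C.q ^ (n + n')).comp (M.C.U 1 (M.β x'))) (EuclideanSpace.single c (1 : ℝ)) c'|)
        ≤ |l.wY (blockIter k x')| * (|M.C.e| ^ (n + n') * (1 / ((n.factorial : ℝ) * n'.factorial)) * (|M.w| * |M.τ x'| ^ n') * 1) :=
          mul_le_mul_of_nonneg_left (mul_le_mul_of_nonneg_left h3 h4) (abs_nonneg _)
      _ = _ := by ring
  · simp only [h, if_false, zero_mul, mul_zero, abs_zero]
    exact le_rfl

/-- (1.15): `UOf ≤ N²·u115` (`|q^m R_{n̄+1}| ≦ 1`, `|U| = 1`). [cite: Balaban1983Higgs3, (1.15) p.414] -/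
theorem UOf_v115_le (M : Model P N k) (dm2 : HiggsLattice.Site P 0 → ℝ) (l : Loc P k) (n nb : ℕ) (x : HiggsLattice.Site P 0) :
    UOf M dm2 l (.v115 n nb) x ≤ (N : ℝ) ^ 2 * u115 M.C M.w M.τ nb n M.Y l.wY x := by
  refine UOf_le_of_site M dm2 l (.v115 n nb) (u115 M.C M.w M.τ nb n M.Y l.wY) (fun b c c' => rfl) (fun x' c c' => ?_) x
  simp only [ubOfKind, u115]
  by_cases h : blockIter k x' ∈ M.Y
  · simp only [h, if_true, mul_one, abs_mul]
    have h1 : op115 M nb n x' (EuclideanSpace.single c (1 : ℝ)) c' =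
        (-(M.C.e ^ (n + nb + 1) * (1 / ((n.factorial : ℝ) * (nb + 1).factorial))) * (M.w * M.τ x' ^ (nb + 1))) *
          ((M.C.q ^ (n + nb + 1) * taylorRemOp nb ((M.C.e * M.τ x') • M.C.q)).comp (M.C.U 1 (M.β x')))
            (EuclideanSpace.single c (1 : ℝ)) c' := by
      simp only [op115, clm_smul_apply', PiLp.smul_apply, smul_eq_mul]
    rw [h1, abs_mul]
    have h2 : |(-(M.C.e ^ (n + nb + 1) * (1 / ((n.factorial : ℝ) * (nb + 1).factorial))) * (M.w * M.τ x' ^ (nb + 1)))| =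
        |M.C.e| ^ (n + nb + 1) * (1 / ((n.factorial : ℝ) * (nb + 1).factorial)) * (|M.w| * |M.τ x'| ^ (nb + 1)) := by
      rw [abs_mul, abs_neg, abs_mul, abs_mul, abs_pow, abs_pow,
        abs_of_pos (by positivity : (0 : ℝ) < 1 / ((n.factorial : ℝ) * (nb + 1).factorial))]
    rw [h2]
    have h3 := abs_op_U_single_apply_le_one M.C _
      (B3VertexTensorBounds.norm_qpow_mul_remOp_le_one M.C (n + nb + 1) nb (M.C.e * M.τ x')) (M.β x') c c'
    have h4 : 0 ≤ |M.C.e| ^ (n + nb + 1) * (1 / ((n.factorial : ℝ) * (nb + 1).factorial)) * (|M.w| * |M.τ x'| ^ (nb + 1)) := by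
      positivity
    calc |l.wY (blockIter k x')| * (|M.C.e| ^ (n + nb + 1) * (1 / ((n.factorial : ℝ) * (nb + 1).factorial)) *
          (|M.w| * |M.τ x'| ^ (nb + 1)) *
          |((M.C.q ^ (n + nb + 1) * taylorRemOp nb ((M.C.e * M.τ x') • M.C.q)).comp (M.C.U 1 (M.β x')))
            (EuclideanSpace.single c (1 : ℝ)) c'|)
        ≤ |l.wY (blockIter k x')| * (|M.C.e| ^ (n + nb + 1) * (1 / ((n.factorial : ℝ) * (nb + 1).factorial)) *
          (|M.w| * |M.τ x'| ^ (nb + 1)) * 1) :=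
          mul_le_mul_of_nonneg_left (mul_le_mul_of_nonneg_left h3 h4) (abs_nonneg _)
      _ = _ := by ring
  · simp only [h, if_false, zero_mul, mul_zero, abs_zero]
    exact le_rfl

/-- **THE VERTEX FUNCTIONS OF THE SIGNED FORM AGAINST FILE 12's**: for every kind,
`UOf_κ(x) ≤ N² · η^{diffCount κ} · uOfKind_κ(x)` — exactly ONE FACTOR `η` PER DIFFERENTIATED LEG has moved from the vertex (where
FILE 12 paid `η⁻¹`) to the line (where (2.11) accounts for it as `(L^jη)⁻¹`); `N²` counts the two channels against `|q| ≦ 1`,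
`|R_{n̄+1}| ≦ 1`, `|U| = 1`.  With FILE 12's explicit `u16`–`u115` this gives explicit vertex bounds for `abs_graphAmp_le_ampE_signed`.
[cite: Balaban1983Higgs3, p.426] [cite: Balaban1983Higgs3, (2.14) p.427] -/
theorem UOf_le_uOfKind (M : Model P N k) (dm2 : HiggsLattice.Site P 0 → ℝ) (l : Loc P k) (κ : VertexKind)
    (x : HiggsLattice.Site P 0) : UOf M dm2 l κ x ≤ (N : ℝ) ^ 2 * P.mesh 0 ^ κ.diffCount * uOfKind M dm2 l κ x := by
  cases κ with
  | v16 => simpa [VertexKind.diffCount, uOfKind] using UOf_v16_le M dm2 l x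
  | v17 => simpa [VertexKind.diffCount, uOfKind] using UOf_v17_le M dm2 l x
  | v18 n n' => simpa [VertexKind.diffCount, uOfKind] using UOf_v18_le M dm2 l n n' x
  | v19 n nb => simpa [VertexKind.diffCount, uOfKind] using UOf_v19_le M dm2 l n nb x
  | v110 n n' => simpa [VertexKind.diffCount, uOfKind] using UOf_v110_le M dm2 l n n' x
  | v111 n nb => simpa [VertexKind.diffCount, uOfKind] using UOf_v111_le M dm2 l n nb x
  | v113 => simpa [VertexKind.diffCount, uOfKind] using UOf_v113_le M dm2 l x
  | v114 n n' => simpa [VertexKind.diffCount, uOfKind] using UOf_v114_le M dm2 l n n' x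
  | v115 n nb => simpa [VertexKind.diffCount, uOfKind] using UOf_v115_le M dm2 l n nb x

end SignedConcrete

end

end Literature.MathematicalPhysics.QuantumFieldTheory.Balaban1983to89.B3GraphAmplitudeSignedPositionForm
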